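import Literature.Geometry.Lorentzian.KerrEnergyIdentity
import Literature.Geometry.Lorentzian.KerrWaveEnergy
import Mathlib.Analysis.Calculus.LineDeriv.IntegrationByParts
import Mathlib.Analysis.Calculus.ParametricIntegral
import Mathlib.Analysis.Calculus.BumpFunction.FiniteDimension
import Mathlib.Analysis.Calculus.MeanValue
import HarnessLib

/-!
# The far-region `J^T` energy identity and finite speed of propagation for the Kerr wave
# equation, proved; gr.S24 boundedness from the Dafermos–Rodnianski–Shlapentokh-Rothman
# theorem alone

(family `gr`, statement **gr.S24** infrastructure; trunk G08 = T-LORENTZ; namespaces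
`Literature.Lorentz`, `Literature.Lorentz.Kerr`, `Literature.GR`)

`KerrWaveEnergy.lean` reduces the named fact `Literature.Geometry.Lorentzian.drsr_wave_boundedness_kerr` of
`BlackHoles.lean` (uniform boundedness of the coordinate energy of smooth solutions of
`□_g ψ = 0` through the leaves `{t* = τ} ∩ {r > r₊}` of the ingoing Kerr–Schild chart) to three
named facts: the printed theorem `DafermosRodnianskiShlapentokhRothman2016_energyBoundedness`
(arXiv:1402.7034, Thm. 3.1 (23) in the generalised form of §3.3), the far-region `J^T` energy
identity `kerr_far_TEnergy_comparison` and finite speed of propagation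
`kerr_finite_speed_of_propagation` (`drsr_wave_boundedness_kerr_of`). This file **proves** the two
analytic ingredients in the (weaker, perturbative/coarse) form the reduction actually needs, from
the coordinate conservation law `∑_μ ∂_μ J^μ = (□_g ψ) ∂_0Φ` of `KerrEnergyIdentity.lean`, and
re-runs the reduction, so that gr.S24 boundedness now rests on the printed theorem alone:

* `Literature.Geometry.Lorentzian.kerr_far_TEnergy_comparison_of_farRadius_le` — **the `J^T` identity in the far region**
  (Dafermos–Rodnianski–Shlapentokh-Rothman arXiv:1402.7034, §2.3.2 with `V = T`, `K^T = 0`,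
  `𝓔^T = 0`): for `R' ≥ R_far(M, a) = max (R_af + 1) (290 M)` (`Kerr.farRadius`; there
  `2H ≤ 1/72`), two `C¹` heights `F₁ ≤ F₂` with slopes `≤ 1/4` agreeing on `{‖y‖ ≤ R'}`, and a
  smooth solution `ψ` vanishing with its differential on the wedge between the two graphs beyond
  some radius, `E^far_{F₂}(τ) ≤ 8 E^far_{F₁}(τ)` and `E^far_{F₁}(τ) ≤ 8 E^far_{F₂}(τ)`
  (`E^far_F = graphSliceEnergyOn … F τ {‖y‖ > R'}`). The divergence theorem is replaced by its
  differential form: along the family of graphs of `F₁ + κ(θ)(F₂ − F₁)` the `∂_{t*}`-flux is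
  differentiable in `θ` (differentiation under the integral sign, with the uniform bounds of
  `Kerr.exists_bound_graphFluxDeriv`) with derivative
  `∫ (∑_i ∂_{y_i}[J^{i+1} κ'Gχ] − κ'G ∑_μ ∂_μJ^μ) dy = 0` (`Kerr.graphFluxDeriv_eq`,
  `Kerr.sum_fderiv_tCurrent_eq_zero`, integration by parts on `E3`), and the flux densities are
  two-sided comparable with `∑(∂Φ)²` (`Kerr.graphFluxDensity_bounds`). The general-`c` statement
  `kerr_far_TEnergy_comparison` (slopes `≤ 1 − c`, `2H ≤ 1 − c`) is *not* discharged here: it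
  needs in addition the `c`-dependent pointwise comparability constant.
* `Literature.Geometry.Lorentzian.kerr_far_finite_speed_of_propagation` — **coarse finite speed of propagation in the far
  region**: a universal `s ≥ 1` such that data vanishing on `{t* = 0, ‖y‖ > ρ}`, `ρ ≥ R_far`,
  force `ψ = dψ = 0` on `{x⁰ ≥ 0, ‖x⃗‖ > ρ + s x⁰}`. Proof by the energy method with the far `J^T`
  identity between the leaf `{t* = 0}` and the graphs of **tent functions** (`tentFn`, built from
  the smooth radial cutoffs `radialTransition`): the far energy through the tent graph is `≤ 8 ×`
  the (vanishing) far energy of the data, so `∑(∂Φ)²` vanishes along the tent (a.e., hence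
  everywhere by continuity), and `ψ` vanishes by integration in `t*`. The sharp statement
  `kerr_finite_speed_of_propagation` (speed `1`, every `ρ`; Bär–Ginoux–Pfäffle 2007, Ch. 3) is
  not needed and not discharged here.
* `Literature.Geometry.Lorentzian.drsr_wave_boundedness_kerr_of_DRSR` — **gr.S24 boundedness from the printed theorem**:
  `DafermosRodnianskiShlapentokhRothman2016_energyBoundedness → drsr_wave_boundedness_kerr`, the
  reduction of `KerrWaveEnergy.lean` (Dafermos–Rodnianski arXiv:1010.5132, §4.6, Prop. 4.6.1:
  "extending initial data, an easy domain of dependence argument, and the fact that `T` is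
  timelike … near infinity") with scale `λ = max (max (4A) (4Ms)) R_far` (slope `≤ 1/4`, speed
  `s`) and the two theorems above in place of the named facts; constant `64 C_A(M, a, F)`.

Auxiliary material: regularity, vanishing and continuity of the current `J^μ = T^μ{}_0` and of
the graph flux densities (`Kerr.contDiffAt_tCurrent`, `Kerr.fderiv_tCurrent_eq_zero_of_fderiv_eq_zero`,
`Kerr.continuousOn_graphFluxDensity`, `Kerr.continuousOn_graphFluxDeriv`), integration by parts
without boundary terms on `E3` (`integral_fderiv_mul_add_mul_fderiv_eq_zero`), integrability over
far regions, the far radius `Kerr.farRadius` with `2H ≤ 1/72` beyond it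
(`Kerr.two_mul_scalarH_le_of_farRadius_le`), radial cutoffs and tent functions with slope bounds.

## References

* M. Dafermos, I. Rodnianski, Y. Shlapentokh-Rothman, *Decay for solutions of the wave equation
  on Kerr exterior spacetimes III: the full subextremal case |a| < M*, arXiv:1402.7034 = Ann. of
  Math. 183 (2016), §2.2.2 (`T` Killing), §2.3.2 (divergence identity, `K^V`, `𝓔^V`), §3.1
  (display after (23): `J ∼ ∑(∂ψ)²`), §3.3 (admissible `Σ̃₀`), Thm. 3.1 (23)
  (key `DafermosRodnianskiShlapentokhrothman2014`).
* M. Dafermos, I. Rodnianski, *Decay for solutions of the wave equation on Kerr exterior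
  spacetimes I–II*, arXiv:1010.5132, §4.6, Prop. 4.6.1 (key `DafermosRodnianski2010KerrSmallA`).
* M. Dafermos, I. Rodnianski, *Lectures on black holes and linear waves*, arXiv:0811.0354,
  App. D (`J^V`, `K^V`, `𝓔^V`) (key `DafermosRodnianski2008`).
* C. Bär, N. Ginoux, F. Pfäffle, *Wave equations on Lorentzian manifolds and quantization*,
  EMS 2007 = arXiv:0806.1036, Ch. 3 (finite speed of propagation) (key `BarGinouxPfaffle2007`).
-/

noncomputable section

open Set Filter
open scoped ContDiff Topology Manifold


namespace Literature.Geometry.Lorentzian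

namespace Kerr

/-! ### Regularity and vanishing of the `∂_{t*}`-current -/

/-- `C^n` regularity of the current `J^ν` at points with `r > 0` where `Φ` is `C^{n+1}` (the
coefficients `g^{μν}` are real-analytic on `{r > 0}`, `Kerr.contDiffAt_inverseMetric`).
[folklore] -/
theorem contDiffAt_tCurrent (M a : ℝ) {Φ : E4 → ℝ} {x : E4} {n : ℕ∞}
    (hΦ : ContDiffAt ℝ (n + 1) Φ x) (hx : 0 < radius a x) (ν : Fin 4) :
    ContDiffAt ℝ n (fun x ↦ tCurrent M a Φ x ν) x := by
  have hd : ∀ μ, ContDiffAt ℝ n (fun x ↦ fderiv ℝ Φ x (E4.basisVector μ)) x := fun μ ↦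
    (hΦ.fderiv_right (m := n) le_rfl).clm_apply contDiffAt_const
  have hg : ∀ α β, ContDiffAt ℝ n (fun x ↦ inverseMetric M a x α β) x := fun α β ↦
    contDiffAt_inverseMetric M a hx α β
  unfold tCurrent
  refine ((ContDiffAt.sum fun μ _ ↦ (hg ν μ).mul (hd μ)).mul (hd 0)).sub
    (contDiffAt_const.mul (contDiffAt_const.mul
      (ContDiffAt.sum fun α _ ↦ ContDiffAt.sum fun β _ ↦ ((hg α β).mul (hd α)).mul (hd β))))

/-- The current is quadratic in `dΦ`, so it vanishes where `dΦ = 0`. [folklore] -/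
theorem tCurrent_eq_zero_of_fderiv_eq_zero (M a : ℝ) {Φ : E4 → ℝ} {x : E4}
    (h : fderiv ℝ Φ x = 0) (ν : Fin 4) : tCurrent M a Φ x ν = 0 := by
  simp [tCurrent, h]

/-- The current is quadratic in `dΦ`, so its *derivative* vanishes where `dΦ = 0` as well
(product rule: every term of `∂_λ J^ν` retains a factor `∂_μΦ(x) = 0`), for `Φ` of class `C²`
at a point with `r > 0`. [folklore] -/
theorem fderiv_tCurrent_eq_zero_of_fderiv_eq_zero (M a : ℝ) {Φ : E4 → ℝ} {x : E4}
    (hΦ : ContDiffAt ℝ 2 Φ x) (hx : 0 < radius a x) (h : fderiv ℝ Φ x = 0) (ν : Fin 4) :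
    fderiv ℝ (fun x ↦ tCurrent M a Φ x ν) x = 0 := by
  have h2 : ContDiffAt ℝ ((1 : ℕ∞) + 1 : ℕ∞) Φ x := by exact_mod_cast hΦ
  have hd : ∀ μ, DifferentiableAt ℝ (fun y ↦ fderiv ℝ Φ y (E4.basisVector μ)) x := fun μ ↦
    ((h2.fderiv_right (m := (1 : ℕ∞)) le_rfl).clm_apply contDiffAt_const).differentiableAt
      one_ne_zero
  have hg : ∀ α β, DifferentiableAt ℝ (fun y ↦ inverseMetric M a y α β) x := fun α β ↦
    (contDiffAt_inverseMetric M a hx α β (n := 1)).differentiableAt one_ne_zero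
  have hp0 : ∀ μ, fderiv ℝ Φ x (E4.basisVector μ) = 0 := fun μ ↦ by simp [h]
  -- a product of two differentiable functions vanishing at `x` has zero derivative at `x`
  have key : ∀ {u v : E4 → ℝ}, DifferentiableAt ℝ u x → DifferentiableAt ℝ v x → u x = 0 →
      v x = 0 → HasFDerivAt (fun y ↦ u y * v y) (0 : E4 →L[ℝ] ℝ) x := by
    intro u v hu hv hu0 hv0
    refine (hu.hasFDerivAt.mul hv.hasFDerivAt).congr_fderiv ?_
    rw [hu0, hv0, zero_smul, zero_smul, add_zero]
  have hA : DifferentiableAt ℝ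
      (fun y ↦ ∑ μ, inverseMetric M a y ν μ * fderiv ℝ Φ y (E4.basisVector μ)) x :=
    DifferentiableAt.fun_sum fun μ _ ↦ (hg ν μ).mul (hd μ)
  have hA0 : ∑ μ, inverseMetric M a x ν μ * fderiv ℝ Φ x (E4.basisVector μ) = 0 := by
    simp [hp0]
  have hQ : ∀ α β, DifferentiableAt ℝ
      (fun y ↦ inverseMetric M a y α β * fderiv ℝ Φ y (E4.basisVector α)) x := fun α β ↦
    (hg α β).mul (hd α)
  have hS : HasFDerivAt (fun y ↦ ∑ α, ∑ β, inverseMetric M a y α β *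
      fderiv ℝ Φ y (E4.basisVector α) * fderiv ℝ Φ y (E4.basisVector β)) (0 : E4 →L[ℝ] ℝ) x := by
    have hα : ∀ α, HasFDerivAt (fun y ↦ ∑ β, inverseMetric M a y α β *
        fderiv ℝ Φ y (E4.basisVector α) * fderiv ℝ Φ y (E4.basisVector β)) (0 : E4 →L[ℝ] ℝ) x :=
      fun α ↦ (HasFDerivAt.fun_sum fun β _ ↦ key (hQ α β) (hd β) (by simp [hp0]) (hp0 β)).congr_fderiv
        Finset.sum_const_zero
    exact (HasFDerivAt.fun_sum fun α _ ↦ hα α).congr_fderiv Finset.sum_const_zero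
  have hT : HasFDerivAt (fun y ↦ tCurrent M a Φ y ν) (0 : E4 →L[ℝ] ℝ) x := by
    refine ((key hA (hd 0) hA0 (hp0 0)).sub ((hS.const_mul (2⁻¹ : ℝ)).const_mul
      (if ν = 0 then (1 : ℝ) else 0))).congr_fderiv ?_
    simp
  exact hT.fderiv

/-- The graph flux density vanishes over points where `dΦ = 0` at the graph point. [folklore] -/
theorem graphFluxDensity_eq_zero_of_fderiv_eq_zero (M a : ℝ) {F : E3 → ℝ} {Φ : E4 → ℝ} {τ : ℝ}
    {y : E3} (h : fderiv ℝ Φ (E4.ofTimeSpace (τ + F y) y) = 0) :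
    graphFluxDensity M a F Φ τ y = 0 := by
  simp [graphFluxDensity, tCurrent_eq_zero_of_fderiv_eq_zero M a h]

/-- The explicit `θ`-derivative `graphFluxDeriv` vanishes over points where `dΦ = 0` at the
graph point (`Φ` of class `C²` there, `r > 0`): all its terms contain `J^ν` or `∂J^ν` at that
point. [folklore] -/
theorem graphFluxDeriv_eq_zero_of_fderiv_eq_zero (M a : ℝ) {Φ : E4 → ℝ} {F₁ G : E3 → ℝ}
    {τ c k : ℝ} {y : E3} (hΦ : ContDiffAt ℝ 2 Φ (E4.ofTimeSpace (τ + (F₁ y + c * G y)) y))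
    (hx : 0 < radius a (E4.ofTimeSpace (τ + (F₁ y + c * G y)) y))
    (h : fderiv ℝ Φ (E4.ofTimeSpace (τ + (F₁ y + c * G y)) y) = 0) :
    graphFluxDeriv M a Φ F₁ G τ c k y = 0 := by
  simp [graphFluxDeriv, tCurrent_eq_zero_of_fderiv_eq_zero M a h,
    fderiv_tCurrent_eq_zero_of_fderiv_eq_zero M a hΦ hx h]

/-- Where the manifold derivative of `ψ : U → ℝ` vanishes, the representative
`Function.extend Subtype.val ψ 0` has zero Fréchet derivative (`OpensChart.mfderiv_eq`).
[folklore] -/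
theorem fderiv_extend_eq_zero {U : TopologicalSpace.Opens E4} {ψ : U → ℝ} {n : ℕ∞ω} (hn : n ≠ 0)
    (hψ : ContMDiff 𝓘(ℝ, E4) 𝓘(ℝ, ℝ) n ψ) (x : U)
    (h : mfderiv 𝓘(ℝ, E4) 𝓘(ℝ, ℝ) ψ x = 0) :
    fderiv ℝ (Function.extend Subtype.val ψ 0) x = 0 := by
  have hrep : ∀ y : U, ψ y = Function.extend Subtype.val ψ 0 y :=
    fun y ↦ (Subtype.val_injective.extend_apply _ _ y).symm
  have hΦ : DifferentiableAt ℝ (Function.extend Subtype.val ψ 0) x :=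
    ((OpensChart.contMDiffAt_iff x ψ _ hrep).mp (hψ x)).differentiableAt hn
  have := OpensChart.mfderiv_eq x ψ _ hrep hΦ
  rw [this] at h
  exact h

/-- The derivative of Mathlib's `Real.smoothTransition` is bounded (it is continuous and
vanishes off `[0, 1]`). [folklore] -/
theorem exists_bound_deriv_smoothTransition :
    ∃ K : ℝ, 0 ≤ K ∧ ∀ t, |deriv Real.smoothTransition t| ≤ K := by
  obtain ⟨B, hB⟩ := (isCompact_Icc (a := (0 : ℝ)) (b := 1)).exists_bound_of_continuousOn
    ((Real.smoothTransition.contDiff (n := 1)).continuous_deriv le_rfl).continuousOn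
  refine ⟨max B 0, le_max_right _ _, fun t ↦ ?_⟩
  rcases lt_trichotomy t 0 with ht | ht | ht
  · have : deriv Real.smoothTransition t = 0 := by
      have hev : Real.smoothTransition =ᶠ[𝓝 t] fun _ ↦ (0 : ℝ) := by
        filter_upwards [Iio_mem_nhds ht] with u hu
        exact Real.smoothTransition.zero_of_nonpos (le_of_lt hu)
      rw [hev.deriv_eq, deriv_const]
    rw [this, abs_zero]; exact le_max_right _ _
  · subst ht
    have := hB 0 ⟨le_rfl, zero_le_one⟩
    rw [Real.norm_eq_abs] at this
    exact this.trans (le_max_left _ _)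
  · rcases le_or_gt t 1 with ht1 | ht1
    · have := hB t ⟨ht.le, ht1⟩
      rw [Real.norm_eq_abs] at this
      exact this.trans (le_max_left _ _)
    · have : deriv Real.smoothTransition t = 0 := by
        have hev : Real.smoothTransition =ᶠ[𝓝 t] fun _ ↦ (1 : ℝ) := by
          filter_upwards [Ioi_mem_nhds ht1] with u hu
          exact Real.smoothTransition.one_of_one_le (le_of_lt hu)
        rw [hev.deriv_eq, deriv_const]
      rw [this, abs_zero]; exact le_max_right _ _

/-- The graph map `y ↦ (τ + F(y), y)` is continuous within a set on which the height is.
[folklore] -/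
theorem continuousWithinAt_graphMap {F : E3 → ℝ} {T : Set E3} {y : E3}
    (hF : ContinuousWithinAt F T y) (τ : ℝ) :
    ContinuousWithinAt (fun y ↦ E4.ofTimeSpace (τ + F y) y) T y := by
  have : (fun y ↦ E4.ofTimeSpace (τ + F y) y) =
      fun y ↦ (τ + F y) • E4.basisVector 0 + E4.spaceEmbed y :=
    funext fun y ↦ E4.ofTimeSpace_eq_smul_add' _ _
  rw [this]
  exact ((continuousWithinAt_const.add hF).smul continuousWithinAt_const).add
    E4.spaceEmbed.continuous.continuousWithinAt

/-- The graph map `y ↦ (τ + F(y), y)` of a `C^n` height is `C^n`. [folklore] -/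
theorem contDiff_graphMap {F : E3 → ℝ} {n : ℕ∞ω} (hF : ContDiff ℝ n F) (τ : ℝ) :
    ContDiff ℝ n (fun y ↦ E4.ofTimeSpace (τ + F y) y) := by
  have : (fun y ↦ E4.ofTimeSpace (τ + F y) y) =
      fun y ↦ (τ + F y) • E4.basisVector 0 + E4.spaceEmbed y :=
    funext fun y ↦ E4.ofTimeSpace_eq_smul_add' _ _
  rw [this]
  exact ((contDiff_const.add hF).smul contDiff_const).add E4.spaceEmbed.contDiff

/-- **Continuity of the current along graphs.** For `Φ` of class `C¹` on an open set
`O ⊆ {r > 0}` and a height `F` continuous on `T` whose graph over `T` lies in `O`,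
`y ↦ J^ν(τ + F(y), y)` is continuous on `T`. [folklore] -/
theorem continuousOn_tCurrent_comp_graph (M a : ℝ) {Φ : E4 → ℝ} {O : Set E4} (hO : IsOpen O)
    (hΦ : ContDiffOn ℝ 1 Φ O) (hOr : ∀ x ∈ O, 0 < radius a x) {F : E3 → ℝ} {T : Set E3}
    (hF : ContinuousOn F T) (τ : ℝ) (hT : ∀ y ∈ T, E4.ofTimeSpace (τ + F y) y ∈ O) (ν : Fin 4) :
    ContinuousOn (fun y ↦ tCurrent M a Φ (E4.ofTimeSpace (τ + F y) y) ν) T := by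
  intro y hy
  have hx := hT y hy
  have h1 : ContDiffAt ℝ (((0 : ℕ∞) + 1 : ℕ∞) : ℕ∞ω) Φ (E4.ofTimeSpace (τ + F y) y) := by
    rw [zero_add]
    exact_mod_cast hΦ.contDiffAt (hO.mem_nhds hx)
  have hJ : ContinuousAt (fun x ↦ tCurrent M a Φ x ν) (E4.ofTimeSpace (τ + F y) y) :=
    (contDiffAt_tCurrent M a h1 (hOr _ hx) ν).continuousAt
  exact ContinuousAt.comp_continuousWithinAt (f := fun y ↦ E4.ofTimeSpace (τ + F y) y) hJ
    (continuousWithinAt_graphMap (hF y hy) τ)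

/-- The partial derivatives of a `C¹` height are continuous. [folklore] -/
theorem continuous_partialE3 {F : E3 → ℝ} (hF : ContDiff ℝ 1 F) (i : Fin 3) :
    Continuous fun y ↦ partialE3 F y i :=
  (hF.continuous_fderiv one_ne_zero).clm_apply continuous_const

/-- **Continuity of the graph flux density** on a set over which the graph stays in an open set
`O ⊆ {r > 0}` where `Φ` is `C¹`, for a `C¹` height. [folklore] -/
theorem continuousOn_graphFluxDensity (M a : ℝ) {Φ : E4 → ℝ} {O : Set E4} (hO : IsOpen O)
    (hΦ : ContDiffOn ℝ 1 Φ O) (hOr : ∀ x ∈ O, 0 < radius a x) {F : E3 → ℝ} (hF : ContDiff ℝ 1 F)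
    {T : Set E3} (τ : ℝ) (hT : ∀ y ∈ T, E4.ofTimeSpace (τ + F y) y ∈ O) :
    ContinuousOn (graphFluxDensity M a F Φ τ) T := by
  have hJ := fun ν ↦
    continuousOn_tCurrent_comp_graph M a hO hΦ hOr hF.continuous.continuousOn τ hT ν
  have hn : ∀ μ, Continuous fun y ↦ graphConormal F y μ := by
    intro μ
    refine Fin.cases ?_ (fun i ↦ ?_) μ
    · simp only [graphConormal_zero]; exact continuous_const
    · simp only [graphConormal_succ]; exact (continuous_partialE3 hF i).neg
  unfold graphFluxDensity
  exact (continuousOn_finsetSum _ fun μ _ ↦ (hJ μ).mul (hn μ).continuousOn).neg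

/-- **Joint continuity of the explicit `θ`-derivative** `(c, k, y) ↦ D(c, k, y)` on
`[0,1] × ℝ × T`, for `Φ` of class `C²` on an open `O ⊆ {r > 0}` containing the graphs of
`F₁ + cG`, `c ∈ [0,1]`, over `T`, and `C¹` heights `F₁, G`. [folklore] -/
theorem continuousOn_graphFluxDeriv (M a : ℝ) {Φ : E4 → ℝ} {O : Set E4} (hO : IsOpen O)
    (hΦ : ContDiffOn ℝ 2 Φ O) (hOr : ∀ x ∈ O, 0 < radius a x) {F₁ G : E3 → ℝ}
    (hF₁ : ContDiff ℝ 1 F₁) (hG : ContDiff ℝ 1 G) {T : Set E3} (τ : ℝ)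
    (hT : ∀ c ∈ Set.Icc (0 : ℝ) 1, ∀ y ∈ T, E4.ofTimeSpace (τ + (F₁ y + c * G y)) y ∈ O) :
    ContinuousOn (fun p : ℝ × ℝ × E3 ↦ graphFluxDeriv M a Φ F₁ G τ p.1 p.2.1 p.2.2)
      (Set.Icc 0 1 ×ˢ Set.univ ×ˢ T) := by
  -- the graph point as a function of `(c, k, y)`
  set Q : ℝ × ℝ × E3 → E4 := fun p ↦ E4.ofTimeSpace (τ + (F₁ p.2.2 + p.1 * G p.2.2)) p.2.2
    with hQ
  have hQc : Continuous Q := by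
    have : Q = fun p ↦ (τ + (F₁ p.2.2 + p.1 * G p.2.2)) • E4.basisVector 0 +
        E4.spaceEmbed p.2.2 :=
      funext fun p ↦ E4.ofTimeSpace_eq_smul_add' _ _
    rw [this]
    refine ((continuous_const.add ((hF₁.continuous.comp (continuous_snd.comp continuous_snd)).add
      (continuous_fst.mul (hG.continuous.comp (continuous_snd.comp continuous_snd))))).smul
        continuous_const).add (E4.spaceEmbed.continuous.comp (continuous_snd.comp continuous_snd))
  have hQO : ∀ p ∈ Set.Icc (0 : ℝ) 1 ×ˢ (Set.univ : Set ℝ) ×ˢ T, Q p ∈ O := by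
    rintro ⟨c, k, y⟩ ⟨hc, -, hy⟩
    exact hT c hc y hy
  -- continuity of `J^ν ∘ Q` and `∂_μ J^ν ∘ Q`
  have hJ : ∀ ν, ContinuousOn (fun p ↦ tCurrent M a Φ (Q p) ν)
      (Set.Icc 0 1 ×ˢ Set.univ ×ˢ T) := by
    intro ν p hp
    have hx := hQO p hp
    have h1 : ContDiffAt ℝ (((0 : ℕ∞) + 1 : ℕ∞) : ℕ∞ω) Φ (Q p) := by
      rw [zero_add]
      exact_mod_cast (hΦ.contDiffAt (hO.mem_nhds hx)).of_le (by norm_num)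
    exact ContinuousAt.comp_continuousWithinAt (f := Q)
      (contDiffAt_tCurrent M a h1 (hOr _ hx) ν).continuousAt hQc.continuousWithinAt
  have hdJ : ∀ μ ν, ContinuousOn (fun p ↦ fderiv ℝ (fun x ↦ tCurrent M a Φ x ν) (Q p)
      (E4.basisVector μ)) (Set.Icc 0 1 ×ˢ Set.univ ×ˢ T) := by
    intro μ ν p hp
    have hx := hQO p hp
    have h2 : ContDiffAt ℝ (((1 : ℕ∞) + 1 : ℕ∞) : ℕ∞ω) Φ (Q p) := by
      exact_mod_cast hΦ.contDiffAt (hO.mem_nhds hx)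
    have hc : ContinuousAt (fun x ↦ fderiv ℝ (fun x ↦ tCurrent M a Φ x ν) x (E4.basisVector μ))
        (Q p) :=
      (((contDiffAt_tCurrent M a h2 (hOr _ hx) ν).fderiv_right (m := 0) le_rfl).continuousAt).clm_apply
        continuousAt_const
    exact ContinuousAt.comp_continuousWithinAt (f := Q) hc hQc.continuousWithinAt
  have hk : Continuous fun p : ℝ × ℝ × E3 ↦ p.2.1 := continuous_fst.comp continuous_snd
  have hc : Continuous fun p : ℝ × ℝ × E3 ↦ p.1 := continuous_fst
  have hGy : Continuous fun p : ℝ × ℝ × E3 ↦ G p.2.2 :=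
    hG.continuous.comp (continuous_snd.comp continuous_snd)
  have hdF₁ : ∀ i, Continuous fun p : ℝ × ℝ × E3 ↦ partialE3 F₁ p.2.2 i := fun i ↦
    (continuous_partialE3 hF₁ i).comp (continuous_snd.comp continuous_snd)
  have hdG : ∀ i, Continuous fun p : ℝ × ℝ × E3 ↦ partialE3 G p.2.2 i := fun i ↦
    (continuous_partialE3 hG i).comp (continuous_snd.comp continuous_snd)
  unfold graphFluxDeriv
  refine (((hk.mul hGy).continuousOn.mul (hdJ 0 0)).neg).add
    (continuousOn_finsetSum _ fun i _ ↦ ?_)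
  exact ((((hk.mul hGy).continuousOn.mul (hdJ 0 i.succ)).mul
    ((hdF₁ i).add (hc.mul (hdG i))).continuousOn)).add
      ((hJ i.succ).mul (hk.mul (hdG i)).continuousOn)

/-- **Uniform bound for the `θ`-derivative** on `[0,1] × [−K, K] × T` for compact `T`
(continuity on a compact set). [folklore] -/
theorem exists_bound_graphFluxDeriv (M a : ℝ) {Φ : E4 → ℝ} {O : Set E4} (hO : IsOpen O)
    (hΦ : ContDiffOn ℝ 2 Φ O) (hOr : ∀ x ∈ O, 0 < radius a x) {F₁ G : E3 → ℝ}
    (hF₁ : ContDiff ℝ 1 F₁) (hG : ContDiff ℝ 1 G) {T : Set E3} (hTc : IsCompact T) (τ K : ℝ)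
    (hT : ∀ c ∈ Set.Icc (0 : ℝ) 1, ∀ y ∈ T, E4.ofTimeSpace (τ + (F₁ y + c * G y)) y ∈ O) :
    ∃ C : ℝ, ∀ c ∈ Set.Icc (0 : ℝ) 1, ∀ k ∈ Set.Icc (-K) K, ∀ y ∈ T,
      |graphFluxDeriv M a Φ F₁ G τ c k y| ≤ C := by
  have hcont := (continuousOn_graphFluxDeriv M a hO hΦ hOr hF₁ hG τ hT).mono
    (show Set.Icc (0 : ℝ) 1 ×ˢ Set.Icc (-K) K ×ˢ T ⊆ Set.Icc 0 1 ×ˢ Set.univ ×ˢ T from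
      Set.prod_mono le_rfl (Set.prod_mono (Set.subset_univ _) le_rfl))
  obtain ⟨C, hC⟩ :=
    (isCompact_Icc.prod (isCompact_Icc.prod hTc)).exists_bound_of_continuousOn hcont
  refine ⟨C, fun c hc k hk y hy ↦ ?_⟩
  have := hC (c, k, y) ⟨hc, hk, hy⟩
  rwa [Real.norm_eq_abs] at this

/-- Slope bound for the interpolated heights `F₁ + c (F₂ − F₁)`, `c ∈ [0, 1]`: a convex
combination of differentials of norm `≤ b` has norm `≤ b`. [folklore] -/
theorem norm_fderiv_interpolate_le {F₁ F₂ : E3 → ℝ} {y : E3} (h₁ : DifferentiableAt ℝ F₁ y)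
    (h₂ : DifferentiableAt ℝ F₂ y) {c b : ℝ} (hc0 : 0 ≤ c) (hc1 : c ≤ 1)
    (hb₁ : ‖fderiv ℝ F₁ y‖ ≤ b) (hb₂ : ‖fderiv ℝ F₂ y‖ ≤ b) :
    ‖fderiv ℝ (fun y ↦ F₁ y + c * (F₂ y - F₁ y)) y‖ ≤ b := by
  have h : HasFDerivAt (fun y ↦ F₁ y + c * (F₂ y - F₁ y))
      (fderiv ℝ F₁ y + c • (fderiv ℝ F₂ y - fderiv ℝ F₁ y)) y :=
    h₁.hasFDerivAt.add ((h₂.hasFDerivAt.sub h₁.hasFDerivAt).const_mul c)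
  rw [h.fderiv]
  have e : fderiv ℝ F₁ y + c • (fderiv ℝ F₂ y - fderiv ℝ F₁ y) =
      (1 - c) • fderiv ℝ F₁ y + c • fderiv ℝ F₂ y := by
    rw [smul_sub, sub_smul, one_smul]; abel
  rw [e]
  calc ‖(1 - c) • fderiv ℝ F₁ y + c • fderiv ℝ F₂ y‖
      ≤ ‖(1 - c) • fderiv ℝ F₁ y‖ + ‖c • fderiv ℝ F₂ y‖ := norm_add_le _ _
    _ = (1 - c) * ‖fderiv ℝ F₁ y‖ + c * ‖fderiv ℝ F₂ y‖ := by
        rw [norm_smul, norm_smul, Real.norm_of_nonneg (by linarith), Real.norm_of_nonneg hc0]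
    _ ≤ (1 - c) * b + c * b :=
        add_le_add (mul_le_mul_of_nonneg_left hb₁ (by linarith)) (mul_le_mul_of_nonneg_left hb₂ hc0)
    _ = b := by ring

end Kerr

/-! ### Integration by parts on `E3` and integrability over far regions -/

open MeasureTheory

/-- A function continuous on an open set, multiplied by a continuous function whose topological
support lies in that set, is continuous everywhere. [folklore] -/
theorem continuous_mul_of_continuousOn {Ω : Set E3} (hΩ : IsOpen Ω) {V g : E3 → ℝ}
    (hV : ContinuousOn V Ω) (hg : Continuous g) (hgs : tsupport g ⊆ Ω) :
    Continuous fun y ↦ V y * g y := by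
  rw [continuous_iff_continuousAt]
  intro z
  by_cases hz : z ∈ Ω
  · exact ((hV z hz).continuousAt (hΩ.mem_nhds hz)).mul hg.continuousAt
  · have hz' : z ∉ tsupport g := fun h ↦ hz (hgs h)
    have hev : (fun y ↦ V y * g y) =ᶠ[𝓝 z] fun _ ↦ 0 := by
      have : g =ᶠ[𝓝 z] 0 := notMem_tsupport_iff_eventuallyEq.mp hz'
      filter_upwards [this] with y hy
      rw [hy, Pi.zero_apply, mul_zero]
    exact (continuousAt_const.congr_of_eventuallyEq hev :)

/-- **Integration by parts on `E3` without boundary terms**: for `V` of class `C¹` on an open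
set `Ω` and `g` of class `C¹` with compact support inside `Ω`, the function
`∂_i V · g + V · ∂_i g = ∂_i (V g)` is integrable and `∫ (∂_i V · g + V · ∂_i g) dy = 0`
(Mathlib's `integral_mul_fderiv_eq_neg_fderiv_mul_of_integrable`). [folklore] -/
theorem integral_fderiv_mul_add_mul_fderiv_eq_zero {Ω : Set E3} (hΩ : IsOpen Ω) {V g : E3 → ℝ}
    (hV : ContDiffOn ℝ 1 V Ω) (hg : ContDiff ℝ 1 g) (hgc : HasCompactSupport g)
    (hgs : tsupport g ⊆ Ω) (i : Fin 3) :
    Integrable (fun y ↦ fderiv ℝ V y (EuclideanSpace.single i 1) * g y +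
        V y * fderiv ℝ g y (EuclideanSpace.single i 1)) ∧
      ∫ y, (fderiv ℝ V y (EuclideanSpace.single i 1) * g y +
        V y * fderiv ℝ g y (EuclideanSpace.single i 1)) = 0 := by
  set v : E3 := EuclideanSpace.single i 1
  have hVc : ContinuousOn V Ω := hV.continuousOn
  have hdVc : ContinuousOn (fun y ↦ fderiv ℝ V y v) Ω :=
    (hV.continuousOn_fderiv_of_isOpen hΩ le_rfl).clm_apply continuousOn_const
  have hgcont : Continuous g := hg.continuous
  have hdg : Continuous fun y ↦ fderiv ℝ g y v :=
    (hg.continuous_fderiv one_ne_zero).clm_apply continuous_const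
  have hdgs : tsupport (fun y ↦ fderiv ℝ g y v) ⊆ Ω :=
    (tsupport_fderiv_apply_subset ℝ v).trans hgs
  have hdgc : HasCompactSupport fun y ↦ fderiv ℝ g y v := hgc.fderiv_apply (𝕜 := ℝ) v
  -- the three integrands are continuous with compact support
  have h1 : Continuous fun y ↦ fderiv ℝ V y v * g y :=
    continuous_mul_of_continuousOn hΩ hdVc hgcont hgs
  have h2 : Continuous fun y ↦ V y * fderiv ℝ g y v :=
    continuous_mul_of_continuousOn hΩ hVc hdg hdgs
  have h3 : Continuous fun y ↦ V y * g y := continuous_mul_of_continuousOn hΩ hVc hgcont hgs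
  have i1 : Integrable fun y ↦ fderiv ℝ V y v * g y :=
    h1.integrable_of_hasCompactSupport hgc.mul_left
  have i2 : Integrable fun y ↦ V y * fderiv ℝ g y v :=
    h2.integrable_of_hasCompactSupport hdgc.mul_left
  have i3 : Integrable fun y ↦ V y * g y := h3.integrable_of_hasCompactSupport hgc.mul_left
  have hibp := integral_mul_fderiv_eq_neg_fderiv_mul_of_integrable (μ := volume) i1 i2 i3
    (fun x hx ↦ (hV.differentiableOn one_ne_zero x (hgs hx)).differentiableAt
      (hΩ.mem_nhds (hgs hx)))
    (fun x _ ↦ hg.differentiable one_ne_zero x)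
  refine ⟨i1.add i2, ?_⟩
  rw [integral_add i1 i2, hibp]
  ring

/-- A function continuous on the closed far region `{R ≤ ‖y‖}` and vanishing on `{ρ ≤ ‖y‖}` is
integrable on the open far region `{R < ‖y‖}` (it is continuous on the compact
`{R ≤ ‖y‖ ≤ ρ}` and zero beyond). [folklore] -/
theorem integrableOn_far_of_continuousOn_of_eq_zero {f : E3 → ℝ} {R ρ : ℝ}
    (hf : ContinuousOn f {y | R ≤ ‖y‖}) (h0 : ∀ y : E3, ρ ≤ ‖y‖ → f y = 0) :
    IntegrableOn f {y | R < ‖y‖} volume := by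
  have hK : IsCompact ({y : E3 | R ≤ ‖y‖} ∩ Metric.closedBall 0 ρ) :=
    (isCompact_closedBall _ _).inter_left (isClosed_le continuous_const continuous_norm)
  have h1 : IntegrableOn f ({y : E3 | R ≤ ‖y‖} ∩ Metric.closedBall 0 ρ) volume :=
    (hf.mono Set.inter_subset_left).integrableOn_compact hK
  have hmeas : MeasurableSet ({y : E3 | R < ‖y‖} \ Metric.closedBall 0 ρ) :=
    (isOpen_lt continuous_const continuous_norm).measurableSet.diff measurableSet_closedBall
  have h2 : IntegrableOn f ({y : E3 | R < ‖y‖} \ Metric.closedBall 0 ρ) volume := by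
    refine integrableOn_zero.congr_fun (fun y hy ↦ ?_) hmeas
    simp only [Set.mem_sdiff, Metric.mem_closedBall, dist_zero_right, not_le] at hy
    exact (h0 y hy.2.le).symm
  refine (h1.union h2).mono_set fun y (hy : R < ‖y‖) ↦ ?_
  by_cases h : y ∈ Metric.closedBall (0 : E3) ρ
  · exact Or.inl ⟨(hy.le : R ≤ ‖y‖), h⟩
  · exact Or.inr ⟨(hy : R < ‖y‖), h⟩

end Literature.Geometry.Lorentzian

namespace Literature.Geometry.Lorentzian.Kerr

/-! ### The far (almost Minkowskian) region `‖x⃗‖ ≥ R_far(M, a)` -/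

/-- The **far radius** `R_far(M, a) = max (R_af + 1) (290 M)`: beyond it the Kerr–Schild leaf
points lie in the exterior chart (`‖y‖ > R_af`, `Kerr.mem_slice_of_lt_norm`) and `2H ≤ 1/72`
(`r ≥ 144 M`), the perturbative regime of `Kerr.graphFluxDensity_bounds`. [folklore] -/
def farRadius (M a : ℝ) : ℝ := max (afRadius a (rPlus M a) + 1) (290 * M)

/-- `R_af < R_far`. [folklore] -/
theorem afRadius_lt_farRadius (M a : ℝ) : afRadius a (rPlus M a) < farRadius M a :=
  (lt_add_one _).trans_le (le_max_left _ _)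

/-- `290 M ≤ R_far`. [folklore] -/
theorem le_farRadius (M a : ℝ) : 290 * M ≤ farRadius M a := le_max_right _ _

/-- `R_far > 0`. [folklore] -/
theorem farRadius_pos (M a : ℝ) : 0 < farRadius M a :=
  (afRadius_pos _ _).trans (afRadius_lt_farRadius M a)

/-- **`2H ≤ 1/72` beyond the far radius**: for subextremal `(M, a)` and `x` in the exterior with
`‖x⃗‖ ≥ R_far ≥ 290 M` one has `r² ≥ ‖x⃗‖² − a² ≥ (290² − 1) M² ≥ (144 M)²`, so
`H ≤ M / r ≤ 1/144` (`Kerr.scalarH_le_div`). [folklore] -/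
theorem two_mul_scalarH_le_of_farRadius_le {M a : ℝ} (hMa : IsSubextremal M a) {x : E4}
    (hx : x ∈ exterior M a) (hfar : farRadius M a ≤ E4.spatialNorm x) :
    2 * scalarH M a x ≤ 1 / 72 := by
  have hM : 0 < M := hMa.pos
  have hr0 : 0 < radius a x := radius_pos_of_mem_region hx
  have ha : a ^ 2 < M ^ 2 := sq_lt_sq' (abs_lt.1 hMa).1 (abs_lt.1 hMa).2
  have h1 := spatialNorm_sq_sub_sq_le_radius_sq a x
  have h290 : 290 * M ≤ E4.spatialNorm x := (le_farRadius M a).trans hfar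
  have hsq : (290 * M) ^ 2 ≤ E4.spatialNorm x ^ 2 :=
    pow_le_pow_left₀ (by positivity) h290 2
  have hr2 : (144 * M) ^ 2 ≤ radius a x ^ 2 := by nlinarith
  have hr : 144 * M ≤ radius a x := by nlinarith [radius_nonneg a x]
  have hH := scalarH_le_div hM.le a hr0
  have : M / radius a x ≤ 1 / 144 := by
    rw [div_le_div_iff₀ hr0 (by norm_num : (0:ℝ) < 144)]
    linarith
  linarith

end Literature.Geometry.Lorentzian.Kerr

namespace Literature.Geometry.Lorentzian

open MeasureTheory

/-! ### The far-region `J^T` energy identity: proof of the perturbative comparison -/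

/-- **The `J^T` energy identity in the far region, proved** (perturbative form of the named
fact `kerr_far_TEnergy_comparison`, sufficient for gr.S24). Let `(M, a)` be subextremal,
`R' ≥ R_far(M, a)` (`Kerr.farRadius`), `F₁ ≤ F₂` two `C¹` height functions with slopes `≤ 1/4`
which coincide on `{‖y‖ ≤ R'}`, `ψ` a smooth solution of `□_g ψ = 0` on the Kerr exterior
(ingoing Kerr–Schild chart) and `τ ∈ ℝ` such that `ψ, dψ` vanish on the wedge
`{τ + F₁(x⃗) ≤ x⁰ ≤ τ + F₂(x⃗), ‖x⃗‖ ≥ ρ}` for some `ρ`. Then the coordinate energies through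
the far parts `{‖y‖ > R'}` of the graphs `{t* = τ + F_i}` satisfy
`E^far_{F₂}(τ) ≤ 8 E^far_{F₁}(τ)` and `E^far_{F₁}(τ) ≤ 8 E^far_{F₂}(τ)`.
Proof (Dafermos–Rodnianski–Shlapentokh-Rothman arXiv:1402.7034, §2.3.2, divergence identity with
`V = T`, `K^T = 0`, `𝓔^T = 0`, in differential form): along the family of graphs of
`F_θ = F₁ + κ(θ)(F₂ − F₁)` (`κ = Real.smoothTransition`) the `∂_{t*}`-flux
`Φ(θ) = ∫_{‖y‖>R'} f_{F_θ}(τ, y) dy` is differentiable with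
`Φ'(θ) = ∫ (∑_i ∂_{y_i}[J^{i+1} κ' G χ] − κ' G ∑_μ ∂_μ J^μ) dy = 0`
(`Kerr.graphFluxDeriv_eq`, `Kerr.sum_fderiv_tCurrent_eq_zero`, integration by parts on `E3`;
differentiation under the integral sign with the uniform bound `Kerr.exists_bound_graphFluxDeriv`,
the integrands being continuous and supported in `{R' ≤ ‖y‖ ≤ max ρ R'}`), hence constant; and
`⅛ ∑(∂Φ)² ≤ f_F ≤ ∑(∂Φ)²` on both graphs (`Kerr.graphFluxDensity_bounds`: `2H ≤ 1/72` beyond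
`R_far`, slopes `≤ 1/4`). [cite: DafermosRodnianskiShlapentokhrothman2014, §2.3.2 (divergence identity, V = T), §2.2.2, §3.1 display after (23)] -/
theorem kerr_far_TEnergy_comparison_of_farRadius_le [Kerr.Facts] [Kerr.SliceFacts] {M a : ℝ}
    (hMa : Kerr.IsSubextremal M a) {F₁ F₂ : E3 → ℝ} {R' : ℝ} (hR' : Kerr.farRadius M a ≤ R')
    (hF₁ : ContDiff ℝ 1 F₁) (hF₂ : ContDiff ℝ 1 F₂)
    (hdF₁ : ∀ y, ‖fderiv ℝ F₁ y‖ ≤ 1 / 4) (hdF₂ : ∀ y, ‖fderiv ℝ F₂ y‖ ≤ 1 / 4)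
    (hagree : ∀ y : E3, ‖y‖ ≤ R' → F₁ y = F₂ y) (hle : ∀ y, F₁ y ≤ F₂ y)
    (ψ : Kerr.exterior M a → ℝ) (τ : ℝ) (hψ : ContMDiff 𝓘(ℝ, E4) 𝓘(ℝ, ℝ) ∞ ψ)
    (hsol : ∀ x, (Kerr.smoothMetric M a (Kerr.rPlus M a)).toPseudoRiemannianMetric.dalembertian
      ψ x = 0)
    (hvan : ∃ ρ : ℝ, ∀ x : Kerr.exterior M a,
        τ + F₁ (E4.spatial (x : E4)) ≤ (x : E4) 0 → (x : E4) 0 ≤ τ + F₂ (E4.spatial (x : E4)) →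
        ρ ≤ E4.spatialNorm (x : E4) → ψ x = 0 ∧ mfderiv 𝓘(ℝ, E4) 𝓘(ℝ, ℝ) ψ x = 0) :
    graphSliceEnergyOn (Kerr.exterior M a) ψ F₂ τ {y | R' < ‖y‖} ≤
        8 * graphSliceEnergyOn (Kerr.exterior M a) ψ F₁ τ {y | R' < ‖y‖} ∧
      graphSliceEnergyOn (Kerr.exterior M a) ψ F₁ τ {y | R' < ‖y‖} ≤
        8 * graphSliceEnergyOn (Kerr.exterior M a) ψ F₂ τ {y | R' < ‖y‖} := by
  classical
  have hM : 0 < M := hMa.pos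
  -- ### the representative `Φ` of `ψ`
  set Φ : E4 → ℝ := Function.extend Subtype.val ψ 0 with hΦ_def
  have hrep : ∀ y : (Kerr.exterior M a), ψ y = Φ y := fun y ↦ (Subtype.val_injective.extend_apply _ _ y).symm
  have hΦat : ∀ x : E4, x ∈ (Kerr.exterior M a) → ContDiffAt ℝ ∞ Φ x := fun x hx ↦
    (OpensChart.contMDiffAt_iff ⟨x, hx⟩ ψ Φ hrep).mp (hψ ⟨x, hx⟩)
  have hΦ2 : ∀ x : E4, x ∈ (Kerr.exterior M a) → ContDiffAt ℝ 2 Φ x := fun x hx ↦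
    (hΦat x hx).of_le (ENat.natCast_le_of_coe_top_le_withTop le_rfl 2)
  have hΦon1 : ContDiffOn ℝ 1 Φ ((Kerr.exterior M a) : Set E4) := fun x hx ↦
    ((hΦat x hx).of_le (ENat.natCast_le_of_coe_top_le_withTop le_rfl 1)).contDiffWithinAt
  have hΦon2 : ContDiffOn ℝ 2 Φ ((Kerr.exterior M a) : Set E4) := fun x hx ↦ (hΦ2 x hx).contDiffWithinAt
  -- ### geometry of the far region
  have hR'af : Kerr.afRadius a (Kerr.rPlus M a) < R' := (Kerr.afRadius_lt_farRadius M a).trans_le hR'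
  have hR'0 : 0 < R' := (Kerr.farRadius_pos M a).trans_le hR'
  have hmemU : ∀ (t : ℝ) (y : E3), R' ≤ ‖y‖ → E4.ofTimeSpace t y ∈ (Kerr.exterior M a) := fun t y hy ↦
    Kerr.ofTimeSpace_mem_exterior_iff.mpr (Kerr.mem_slice_of_lt_norm (hR'af.trans_le hy))
  have hUr : ∀ x ∈ ((Kerr.exterior M a) : Set E4), 0 < Kerr.radius a x := fun x hx ↦
    Kerr.radius_pos_of_mem_region hx
  have hH : ∀ (t : ℝ) (y : E3), R' ≤ ‖y‖ →
      2 * Kerr.scalarH M a (E4.ofTimeSpace t y) ≤ 1 / 72 := fun t y hy ↦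
    Kerr.two_mul_scalarH_le_of_farRadius_le hMa (hmemU t y hy)
      (by rw [E4.spatialNorm_ofTimeSpace]; exact hR'.trans hy)
  -- ### the interpolating family of heights `F_θ = F₁ + κ(θ) G`
  set G : E3 → ℝ := fun y ↦ F₂ y - F₁ y with hG_def
  have hG : ContDiff ℝ 1 G := hF₂.sub hF₁
  have hG0 : ∀ y, 0 ≤ G y := fun y ↦ sub_nonneg.mpr (hle y)
  have hGR : ∀ y : E3, ‖y‖ ≤ R' → G y = 0 := fun y hy ↦ by
    simp only [hG_def, hagree y hy, sub_self]
  have hF₁d : ∀ y, DifferentiableAt ℝ F₁ y := fun y ↦ hF₁.differentiable one_ne_zero y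
  have hF₂d : ∀ y, DifferentiableAt ℝ F₂ y := fun y ↦ hF₂.differentiable one_ne_zero y
  have hGd : ∀ y, DifferentiableAt ℝ G y := fun y ↦ hG.differentiable one_ne_zero y
  set κ : ℝ → ℝ := Real.smoothTransition with hκ_def
  have hκd : ∀ θ, HasDerivAt κ (deriv κ θ) θ := fun θ ↦
    ((Real.smoothTransition.contDiff (n := 1)).differentiable one_ne_zero θ).hasDerivAt
  have hκ01 : ∀ θ, 0 ≤ κ θ ∧ κ θ ≤ 1 := fun θ ↦
    ⟨Real.smoothTransition.nonneg θ, Real.smoothTransition.le_one θ⟩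
  obtain ⟨Kκ, hKκ0, hKκ⟩ := Kerr.exists_bound_deriv_smoothTransition
  -- slope bound and wedge property of the interpolated heights
  have hdFc : ∀ c : ℝ, 0 ≤ c → c ≤ 1 → ∀ y,
      ‖fderiv ℝ (fun y ↦ F₁ y + c * G y) y‖ ≤ 1 / 4 := fun c hc0 hc1 y ↦
    Kerr.norm_fderiv_interpolate_le (hF₁d y) (hF₂d y) hc0 hc1 (hdF₁ y) (hdF₂ y)
  -- ### vanishing far out: `dΦ = 0` at the graph points of the family over `‖y‖ ≥ ρ'`
  obtain ⟨ρ, hρ⟩ := hvan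
  set ρ' : ℝ := max ρ R' with hρ'_def
  have hvan' : ∀ c : ℝ, 0 ≤ c → c ≤ 1 → ∀ y : E3, ρ' ≤ ‖y‖ →
      fderiv ℝ Φ (E4.ofTimeSpace (τ + (F₁ y + c * G y)) y) = 0 := by
    intro c hc0 hc1 y hy
    have hyR : R' ≤ ‖y‖ := (le_max_right _ _).trans hy
    have hx : E4.ofTimeSpace (τ + (F₁ y + c * G y)) y ∈ (Kerr.exterior M a) := hmemU _ y hyR
    have h := hρ ⟨_, hx⟩ ?_ ?_ ?_
    · exact Kerr.fderiv_extend_eq_zero (by simp) hψ ⟨_, hx⟩ h.2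
    · show τ + F₁ (E4.spatial (E4.ofTimeSpace _ y)) ≤ (E4.ofTimeSpace _ y) 0
      rw [E4.spatial_ofTimeSpace, E4.ofTimeSpace_apply_zero]
      nlinarith [hG0 y]
    · show (E4.ofTimeSpace _ y) 0 ≤ τ + F₂ (E4.spatial (E4.ofTimeSpace _ y))
      rw [E4.spatial_ofTimeSpace, E4.ofTimeSpace_apply_zero]
      have : G y = F₂ y - F₁ y := rfl
      nlinarith [hG0 y]
    · show ρ ≤ E4.spatialNorm (E4.ofTimeSpace _ y)
      rw [E4.spatialNorm_ofTimeSpace]; exact (le_max_left _ _).trans hy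
  -- ### the flux density family `f θ`, its explicit `θ`-derivative `f' θ`, the far region `S`
  set S : Set E3 := {y | R' < ‖y‖} with hS_def
  set T : Set E3 := {y | R' ≤ ‖y‖} with hT_def
  have hS_meas : MeasurableSet S := (isOpen_lt continuous_const continuous_norm).measurableSet
  have hT_closed : IsClosed T := isClosed_le continuous_const continuous_norm
  have hST : S ⊆ T := fun y (hy : R' < ‖y‖) ↦ (hy.le : R' ≤ ‖y‖)
  obtain ⟨f, hf⟩ : ∃ f : ℝ → E3 → ℝ,
      f = fun θ y ↦ Kerr.graphFluxDensity M a (fun y ↦ F₁ y + κ θ * G y) Φ τ y := ⟨_, rfl⟩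
  obtain ⟨f', hf'⟩ : ∃ f' : ℝ → E3 → ℝ,
      f' = fun θ y ↦ Kerr.graphFluxDeriv M a Φ F₁ G τ (κ θ) (deriv κ θ) y := ⟨_, rfl⟩
  -- continuity of `f θ` on `T`
  have hf_cont : ∀ θ, ContinuousOn (f θ) T := fun θ ↦ by
    rw [hf]
    exact Kerr.continuousOn_graphFluxDensity M a (Kerr.exterior M a).isOpen hΦon1 hUr
      (hF₁.add (contDiff_const.mul hG)) τ (fun y hy ↦ hmemU _ y hy)
  -- vanishing of `f θ` and `f' θ` over `‖y‖ ≥ ρ'`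
  have hf_zero : ∀ θ (y : E3), ρ' ≤ ‖y‖ → f θ y = 0 := fun θ y hy ↦ by
    rw [hf]
    exact Kerr.graphFluxDensity_eq_zero_of_fderiv_eq_zero M a
      (hvan' (κ θ) (hκ01 θ).1 (hκ01 θ).2 y hy)
  have hf'_zero : ∀ θ (y : E3), ρ' ≤ ‖y‖ → f' θ y = 0 := fun θ y hy ↦ by
    rw [hf']
    have hx := hmemU (τ + (F₁ y + κ θ * G y)) y ((le_max_right _ _).trans hy)
    exact Kerr.graphFluxDeriv_eq_zero_of_fderiv_eq_zero M a (hΦ2 _ hx) (hUr _ hx)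
      (hvan' (κ θ) (hκ01 θ).1 (hκ01 θ).2 y hy)
  -- integrability of `f θ` on `S`
  have hf_int : ∀ θ, IntegrableOn (f θ) S volume := fun θ ↦
    integrableOn_far_of_continuousOn_of_eq_zero (hf_cont θ) (hf_zero θ)
  -- differentiability of the current at graph points over `T`
  have hJd : ∀ (t : ℝ) (y : E3), R' ≤ ‖y‖ → ∀ ν,
      DifferentiableAt ℝ (fun x ↦ Kerr.tCurrent M a Φ x ν) (E4.ofTimeSpace t y) := by
    intro t y hy ν
    have hx := hmemU t y hy
    have h2 : ContDiffAt ℝ ((1 : ℕ∞) + 1 : ℕ∞) Φ (E4.ofTimeSpace t y) := by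
      exact_mod_cast hΦ2 _ hx
    exact (Kerr.contDiffAt_tCurrent M a h2 (hUr _ hx) ν).differentiableAt one_ne_zero
  -- ### the flux `Flux θ = ∫_S f θ` and its derivative
  obtain ⟨Flux, hFlux⟩ : ∃ Flux : ℝ → ℝ, Flux = fun θ ↦ ∫ y in S, f θ y := ⟨_, rfl⟩
  have hFlux_deriv : ∀ θ₀, HasDerivAt Flux (∫ y in S, f' θ₀ y) θ₀ := by
    intro θ₀
    have hT'c : IsCompact (T ∩ Metric.closedBall (0 : E3) ρ') :=
      (isCompact_closedBall _ _).inter_left hT_closed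
    obtain ⟨C, hC⟩ := Kerr.exists_bound_graphFluxDeriv M a (Kerr.exterior M a).isOpen hΦon2 hUr hF₁ hG hT'c τ Kκ
      (fun c _ y hy ↦ hmemU _ y hy.1)
    have hbound_int : Integrable
        ((Metric.closedBall (0 : E3) ρ').indicator fun _ ↦ max C 0) (volume.restrict S) := by
      refine Integrable.restrict ?_
      rw [integrable_indicator_iff measurableSet_closedBall]
      exact integrableOn_const (measure_closedBall_lt_top.ne)
    have key := hasDerivAt_integral_of_dominated_loc_of_deriv_le (μ := volume.restrict S)
      (F := f) (F' := f') (x₀ := θ₀) (s := Metric.ball θ₀ 1)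
      (bound := (Metric.closedBall (0 : E3) ρ').indicator fun _ ↦ max C 0)
      (Metric.ball_mem_nhds θ₀ one_pos) ?_ (hf_int θ₀) ?_ ?_ hbound_int ?_
    · rw [hFlux]; exact key.2
    · exact Filter.Eventually.of_forall fun θ ↦
        ((hf_cont θ).mono hST).aestronglyMeasurable hS_meas
    · -- `f' θ₀` is continuous on `T`
      have hc := Kerr.continuousOn_graphFluxDeriv M a (Kerr.exterior M a).isOpen hΦon2 hUr hF₁ hG τ
        (T := T) (fun c _ y hy ↦ hmemU _ y hy)
      have hι : Continuous fun y : E3 ↦ ((κ θ₀, deriv κ θ₀, y) : ℝ × ℝ × E3) :=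
        continuous_const.prodMk (continuous_const.prodMk continuous_id)
      have hmaps : Set.MapsTo (fun y : E3 ↦ ((κ θ₀, deriv κ θ₀, y) : ℝ × ℝ × E3)) T
          (Set.Icc 0 1 ×ˢ Set.univ ×ˢ T) := fun y hy ↦
        ⟨⟨(hκ01 θ₀).1, (hκ01 θ₀).2⟩, Set.mem_univ _, hy⟩
      have hc' : ContinuousOn (f' θ₀) T := by
        rw [hf']
        exact hc.comp hι.continuousOn hmaps
      exact (hc'.mono hST).aestronglyMeasurable hS_meas
    · refine (ae_restrict_mem hS_meas).mono fun y hy θ _ ↦ ?_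
      by_cases hyρ : ‖y‖ ≤ ρ'
      · have hyB : y ∈ Metric.closedBall (0 : E3) ρ' := by
          simpa only [Metric.mem_closedBall, dist_zero_right] using hyρ
        rw [Set.indicator_of_mem hyB, Real.norm_eq_abs, hf']
        have hk : deriv κ θ ∈ Set.Icc (-Kκ) Kκ := abs_le.mp (hKκ θ)
        exact (hC (κ θ) ⟨(hκ01 θ).1, (hκ01 θ).2⟩ (deriv κ θ) hk y ⟨hST hy, hyB⟩).trans
          (le_max_left _ _)
      · rw [hf'_zero θ y (le_of_not_ge hyρ), norm_zero]
        exact Set.indicator_nonneg (fun _ _ ↦ le_max_right _ _) y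
    · refine (ae_restrict_mem hS_meas).mono fun y hy θ _ ↦ ?_
      rw [hf, hf']
      exact Kerr.hasDerivAt_graphFluxDensity M a Φ F₁ G (hκd θ) τ y (hF₁d y) (hGd y)
        (hJd _ y (hST hy))
  -- ### the derivative of the flux vanishes: divergence identity + integration by parts
  have hFlux_zero : ∀ θ, ∫ y in S, f' θ y = 0 := by
    intro θ
    set c : ℝ := κ θ with hc_def
    set k : ℝ := deriv κ θ with hk_def
    -- the graph map, the spatial components of the current along it, the domain `Ω`
    obtain ⟨P, hP⟩ : ∃ P : E3 → E4, P = fun y ↦ E4.ofTimeSpace (τ + (F₁ y + c * G y)) y :=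
      ⟨_, rfl⟩
    have hPd : ∀ y, DifferentiableAt ℝ P y := fun y ↦ by
      rw [hP]
      exact (E4.hasFDerivAt_graphMap (F := fun y ↦ F₁ y + c * G y)
        ((hF₁d y).add ((hGd y).const_mul c)).hasFDerivAt τ).differentiableAt
    have hP1 : ContDiff ℝ 1 P := by
      rw [hP]; exact Kerr.contDiff_graphMap (hF₁.add (contDiff_const.mul hG)) τ
    have hPU : ∀ y : E3, R' ≤ ‖y‖ → P y ∈ (Kerr.exterior M a) := fun y hy ↦ by rw [hP]; exact hmemU _ y hy
    set Ω : Set E3 := {y | Kerr.afRadius a (Kerr.rPlus M a) < ‖y‖} with hΩ_def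
    have hΩ : IsOpen Ω := isOpen_lt continuous_const continuous_norm
    have hTΩ : T ⊆ Ω := fun y hy ↦ hR'af.trans_le hy
    have hPΩ : ∀ y ∈ Ω, P y ∈ (Kerr.exterior M a) := fun y hy ↦ by
      rw [hP]; exact Kerr.ofTimeSpace_mem_exterior_iff.mpr (Kerr.mem_slice_of_lt_norm hy)
    obtain ⟨V, hV⟩ : ∃ V : Fin 3 → E3 → ℝ, V = fun i y ↦ Kerr.tCurrent M a Φ (P y) i.succ :=
      ⟨_, rfl⟩
    have hV1 : ∀ i, ContDiffOn ℝ 1 (V i) Ω := by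
      intro i y hy
      have hyU := hPΩ y hy
      have h2 : ContDiffAt ℝ ((1 : ℕ∞) + 1 : ℕ∞) Φ (P y) := by exact_mod_cast hΦ2 _ hyU
      have hJ : ContDiffAt ℝ (1 : ℕ∞) (fun x ↦ Kerr.tCurrent M a Φ x i.succ) (P y) :=
        Kerr.contDiffAt_tCurrent M a h2 (hUr _ hyU) i.succ
      rw [hV]
      exact (hJ.comp y hP1.contDiffAt).contDiffWithinAt
    -- the cutoff `χ = 1` on `closedBall 0 (ρ' + 1)` and the test function `g = k G χ`
    let χ : ContDiffBump (0 : E3) := ⟨ρ' + 1, ρ' + 2, by linarith [le_max_right ρ R'], by linarith⟩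
    obtain ⟨g, hg⟩ : ∃ g : E3 → ℝ, g = fun y ↦ k * G y * χ y := ⟨_, rfl⟩
    have hg1 : ContDiff ℝ 1 g := by rw [hg]; exact (contDiff_const.mul hG).mul χ.contDiff
    have hgd : ∀ y, DifferentiableAt ℝ g y := fun y ↦ hg1.differentiable one_ne_zero y
    have hgc : HasCompactSupport g := by rw [hg]; exact χ.hasCompactSupport.mul_left
    have hG_tsupp : tsupport G ⊆ T := by
      refine closure_minimal (fun y hy ↦ ?_) hT_closed
      by_contra hyT
      exact hy (hGR y (le_of_not_ge hyT))
    have hg_tsupp : tsupport g ⊆ Ω := by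
      rw [hg]
      refine (tsupport_mul_subset_left.trans ?_).trans (hG_tsupp.trans hTΩ)
      exact tsupport_mul_subset_right
    -- integration by parts, summed over `i`
    have hibp := fun i ↦ integral_fderiv_mul_add_mul_fderiv_eq_zero hΩ (hV1 i) hg1 hgc hg_tsupp i
    obtain ⟨w, hw⟩ : ∃ w : E3 → ℝ, w = fun y ↦ ∑ i : Fin 3,
        (fderiv ℝ (V i) y (EuclideanSpace.single i 1) * g y +
          V i y * fderiv ℝ g y (EuclideanSpace.single i 1)) := ⟨_, rfl⟩
    have hw_int : ∫ y, w y = 0 := by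
      rw [hw, integral_finsetSum _ fun i _ ↦ (hibp i).1]
      exact Finset.sum_eq_zero fun i _ ↦ (hibp i).2
    -- `w = f' θ` on `S`
    have hw_S : ∀ y ∈ S, f' θ y = w y := by
      intro y hy
      have hyT : R' ≤ ‖y‖ := hST hy
      by_cases hyρ : ρ' + 1 ≤ ‖y‖
      · -- far out both sides vanish
        have hy' : ρ' ≤ ‖y‖ := by linarith
        have hdΦ : fderiv ℝ Φ (P y) = 0 := by rw [hP]; exact hvan' c (hκ01 θ).1 (hκ01 θ).2 y hy'
        have hyU := hPU y hyT
        have hV0 : ∀ i, V i y = 0 := fun i ↦ by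
          rw [hV]; exact Kerr.tCurrent_eq_zero_of_fderiv_eq_zero M a hdΦ _
        have hdV0 : ∀ i, fderiv ℝ (V i) y = 0 := by
          intro i
          have hJd' : DifferentiableAt ℝ (fun x ↦ Kerr.tCurrent M a Φ x i.succ) (P y) := by
            rw [hP]; exact hJd _ y hyT i.succ
          have hVi : V i = (fun x ↦ Kerr.tCurrent M a Φ x i.succ) ∘ P := by rw [hV]; rfl
          rw [hVi, fderiv_comp y hJd' (hPd y),
            Kerr.fderiv_tCurrent_eq_zero_of_fderiv_eq_zero M a (hΦ2 _ hyU) (hUr _ hyU) hdΦ,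
            ContinuousLinearMap.zero_comp]
        rw [hf'_zero θ y hy', hw]
        simp [hV0, hdV0]
      · push Not at hyρ
        -- near: `g = k G` near `y`, product rule, and `∑_μ ∂_μ J^μ = 0`
        have hχ1 : ∀ᶠ z in 𝓝 y, χ z = 1 := by
          have : Metric.ball (0 : E3) (ρ' + 1) ∈ 𝓝 y :=
            Metric.isOpen_ball.mem_nhds (by simpa only [Metric.mem_ball, dist_zero_right])
          filter_upwards [this] with z hz
          exact χ.one_of_mem_closedBall (Metric.ball_subset_closedBall hz)
        have hg_ev : (fun z ↦ k * G z) =ᶠ[𝓝 y] g := by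
          filter_upwards [hχ1] with z hz
          rw [hg]; simp only [hz, mul_one]
        have hyU := hPU y hyT
        have hJdy : ∀ ν, DifferentiableAt ℝ (fun x ↦ Kerr.tCurrent M a Φ x ν)
            (E4.ofTimeSpace (τ + (F₁ y + c * G y)) y) := hJd _ y hyT
        have hdiv : ∑ μ, fderiv ℝ (fun x ↦ Kerr.tCurrent M a Φ x μ)
            (E4.ofTimeSpace (τ + (F₁ y + c * G y)) y) (E4.basisVector μ) = 0 :=
          Kerr.sum_fderiv_tCurrent_eq_zero M a (Kerr.rPlus M a) hrep ⟨_, hmemU _ y hyT⟩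
            (hΦ2 _ (hmemU _ y hyT)) (hsol _)
        have e1 : f' θ y = ∑ i : Fin 3, fderiv ℝ (fun y ↦ V i y * (k * G y)) y
            (EuclideanSpace.single i 1) := by
          rw [hf', hV]
          show Kerr.graphFluxDeriv M a Φ F₁ G τ c k y = _
          rw [Kerr.graphFluxDeriv_eq M a Φ F₁ G τ c k y (hF₁d y) (hGd y) hJdy, hdiv, mul_zero,
            sub_zero, hP]
        rw [e1, hw]
        refine Finset.sum_congr rfl fun i _ ↦ ?_
        have hVd : DifferentiableAt ℝ (V i) y :=
          ((hV1 i).differentiableOn one_ne_zero y (hTΩ hyT)).differentiableAt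
            (hΩ.mem_nhds (hTΩ hyT))
        have hev : (fun z ↦ V i z * (k * G z)) =ᶠ[𝓝 y] fun z ↦ V i z * g z := by
          filter_upwards [hg_ev] with z hz
          rw [hz]
        rw [hev.fderiv_eq, fderiv_fun_mul hVd (hgd y)]
        simp only [add_apply, FunLike.coe_smul, Pi.smul_apply, smul_eq_mul]
        ring
    -- `w = 0` off `S`
    have hw_Sc : ∀ y, y ∉ S → w y = 0 := by
      intro y hy
      have hyR : ‖y‖ ≤ R' := not_lt.mp hy
      have hGy : G y = 0 := hGR y hyR
      have hdGy : fderiv ℝ G y = 0 := by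
        have hmin : IsLocalMin G y :=
          Filter.Eventually.of_forall fun z ↦ (by rw [hGy]; exact hG0 z : G y ≤ G z)
        exact hmin.fderiv_eq_zero
      have hgy : g y = 0 := by rw [hg]; simp [hGy]
      have hdgy : fderiv ℝ g y = 0 := by
        have h1 : DifferentiableAt ℝ (fun z ↦ k * G z) y := (hGd y).const_mul k
        have h2 : DifferentiableAt ℝ (fun z ↦ (χ : E3 → ℝ) z) y :=
          χ.contDiff.differentiable one_ne_zero y
        rw [hg, fderiv_fun_mul h1 h2, fderiv_const_mul (hGd y), hdGy, hGy]
        simp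
      rw [hw]
      simp [hgy, hdgy]
    -- conclusion
    calc ∫ y in S, f' θ y = ∫ y in S, w y := setIntegral_congr_fun hS_meas hw_S
      _ = ∫ y, w y := setIntegral_eq_integral_of_forall_compl_eq_zero hw_Sc
      _ = 0 := hw_int
  -- ### the flux is constant in `θ`
  have hFlux_const : Flux 0 = Flux 1 := by
    have hd : ∀ θ, HasDerivAt Flux 0 θ := fun θ ↦ by simpa [hFlux_zero θ] using hFlux_deriv θ
    exact is_const_of_deriv_eq_zero (fun θ ↦ (hd θ).differentiableAt) (fun θ ↦ (hd θ).deriv) 0 1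
  -- ### comparison of flux densities and energy densities on `S`
  have hbounds : ∀ F : E3 → ℝ, (∀ y, ‖fderiv ℝ F y‖ ≤ 1 / 4) → ∀ y ∈ S,
      (1 / 8) * coordEnergyDensity (Kerr.exterior M a) ψ (E4.ofTimeSpace (τ + F y) y) ≤
          Kerr.graphFluxDensity M a F Φ τ y ∧
        Kerr.graphFluxDensity M a F Φ τ y ≤
          coordEnergyDensity (Kerr.exterior M a) ψ (E4.ofTimeSpace (τ + F y) y) := by
    intro F hdF y hy
    have h := Kerr.graphFluxDensity_bounds hM.le a F Φ τ y (hUr _ (hmemU _ y (hST hy)))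
      (hH _ y (hST hy)) (hdF y)
    rwa [Kerr.sum_sq_fderiv_extend_eq] at h
  have hE : ∀ F : E3 → ℝ, graphSliceEnergyOn (Kerr.exterior M a) ψ F τ S =
      ∫⁻ y in S, ENNReal.ofReal (coordEnergyDensity (Kerr.exterior M a) ψ (E4.ofTimeSpace (τ + F y) y)) := by
    intro F
    unfold graphSliceEnergyOn
    refine setLIntegral_congr_fun hS_meas fun y hy ↦ ?_
    rw [Set.indicator_of_mem]
    exact hmemU _ y (hST hy)
  have hA_le : ∀ F : E3 → ℝ, (∀ y, ‖fderiv ℝ F y‖ ≤ 1 / 4) →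
      (∫⁻ y in S, ENNReal.ofReal (Kerr.graphFluxDensity M a F Φ τ y)) ≤
        graphSliceEnergyOn (Kerr.exterior M a) ψ F τ S := by
    intro F hdF
    rw [hE F]
    exact setLIntegral_mono' hS_meas fun y hy ↦ ENNReal.ofReal_le_ofReal (hbounds F hdF y hy).2
  have hE_le : ∀ F : E3 → ℝ, (∀ y, ‖fderiv ℝ F y‖ ≤ 1 / 4) →
      graphSliceEnergyOn (Kerr.exterior M a) ψ F τ S ≤
        8 * ∫⁻ y in S, ENNReal.ofReal (Kerr.graphFluxDensity M a F Φ τ y) := by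
    intro F hdF
    rw [hE F, ← lintegral_const_mul' _ _ (by norm_num)]
    refine setLIntegral_mono' hS_meas fun y hy ↦ ?_
    rw [← ENNReal.ofReal_ofNat, ← ENNReal.ofReal_mul (by norm_num)]
    exact ENNReal.ofReal_le_ofReal (by linarith [(hbounds F hdF y hy).1])
  -- the `lintegral` of the flux density is `ofReal` of the flux
  have hA_eq : ∀ θ, (∫⁻ y in S, ENNReal.ofReal (f θ y)) = ENNReal.ofReal (Flux θ) := by
    intro θ
    rw [hFlux, ofReal_integral_eq_lintegral_ofReal (hf_int θ)]
    refine (ae_restrict_mem hS_meas).mono fun y hy ↦ ?_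
    have hb := (hbounds (fun y ↦ F₁ y + κ θ * G y) (hdFc (κ θ) (hκ01 θ).1 (hκ01 θ).2) y hy).1
    rw [hf]
    exact le_trans (mul_nonneg (by norm_num) (coordEnergyDensity_nonneg _ _ _)) hb
  have hf0 : ∀ y, f 0 y = Kerr.graphFluxDensity M a F₁ Φ τ y := fun y ↦ by
    rw [hf]
    simp only [hκ_def, Real.smoothTransition.zero_of_nonpos le_rfl, zero_mul, add_zero]
  have hf1 : ∀ y, f 1 y = Kerr.graphFluxDensity M a F₂ Φ τ y := fun y ↦ by
    rw [hf]
    simp only [hκ_def, Real.smoothTransition.one_of_one_le le_rfl, one_mul, hG_def,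
      add_sub_cancel]
  have hA0 : (∫⁻ y in S, ENNReal.ofReal (Kerr.graphFluxDensity M a F₁ Φ τ y)) =
      ENNReal.ofReal (Flux 0) := by
    rw [← hA_eq 0]; simp only [hf0]
  have hA1 : (∫⁻ y in S, ENNReal.ofReal (Kerr.graphFluxDensity M a F₂ Φ τ y)) =
      ENNReal.ofReal (Flux 1) := by
    rw [← hA_eq 1]; simp only [hf1]
  -- ### conclusion
  constructor
  · calc graphSliceEnergyOn (Kerr.exterior M a) ψ F₂ τ S
        ≤ 8 * ∫⁻ y in S, ENNReal.ofReal (Kerr.graphFluxDensity M a F₂ Φ τ y) := hE_le F₂ hdF₂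
      _ = 8 * ∫⁻ y in S, ENNReal.ofReal (Kerr.graphFluxDensity M a F₁ Φ τ y) := by
          rw [hA1, hA0, hFlux_const]
      _ ≤ 8 * graphSliceEnergyOn (Kerr.exterior M a) ψ F₁ τ S := by gcongr; exact hA_le F₁ hdF₁
  · calc graphSliceEnergyOn (Kerr.exterior M a) ψ F₁ τ S
        ≤ 8 * ∫⁻ y in S, ENNReal.ofReal (Kerr.graphFluxDensity M a F₁ Φ τ y) := hE_le F₁ hdF₁
      _ = 8 * ∫⁻ y in S, ENNReal.ofReal (Kerr.graphFluxDensity M a F₂ Φ τ y) := by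
          rw [hA1, hA0, hFlux_const]
      _ ≤ 8 * graphSliceEnergyOn (Kerr.exterior M a) ψ F₂ τ S := by gcongr; exact hA_le F₂ hdF₂

end Literature.Geometry.Lorentzian

namespace Literature.Geometry.Lorentzian

/-! ### Radial cutoffs and tent functions on `E3` -/

/-- The **radial transition** `u_{c,L}(y) = χ(L⁻¹(‖y‖ − c))` (`χ = Real.smoothTransition`):
`0` on `{‖y‖ ≤ c}`, `1` on `{‖y‖ ≥ c + L}`, values in `[0, 1]`. [folklore] -/
def radialTransition (c L : ℝ) (y : E3) : ℝ := Real.smoothTransition (L⁻¹ * (‖y‖ - c))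

/-- `0 ≤ u_{c,L}`. [folklore] -/
theorem radialTransition_nonneg (c L : ℝ) (y : E3) : 0 ≤ radialTransition c L y :=
  Real.smoothTransition.nonneg _

/-- `u_{c,L} ≤ 1`. [folklore] -/
theorem radialTransition_le_one (c L : ℝ) (y : E3) : radialTransition c L y ≤ 1 :=
  Real.smoothTransition.le_one _

/-- `u_{c,L} = 0` on the closed ball of radius `c` (`L > 0`). [folklore] -/
theorem radialTransition_of_norm_le {c L : ℝ} (hL : 0 < L) {y : E3} (hy : ‖y‖ ≤ c) :
    radialTransition c L y = 0 :=
  Real.smoothTransition.zero_of_nonpos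
    (mul_nonpos_of_nonneg_of_nonpos (inv_nonneg.mpr hL.le) (by linarith))

/-- `u_{c,L} = 1` beyond radius `c + L` (`L > 0`). [folklore] -/
theorem radialTransition_of_le_norm {c L : ℝ} (hL : 0 < L) {y : E3} (hy : c + L ≤ ‖y‖) :
    radialTransition c L y = 1 := by
  refine Real.smoothTransition.one_of_one_le ?_
  rw [← div_eq_inv_mul, le_div_iff₀ hL]
  linarith

/-- The radial transition is smooth for `c > 0`, `L > 0` (the norm is smooth off the origin, and
`u_{c,L}` vanishes on the ball of radius `c` around the origin). [folklore] -/
theorem contDiff_radialTransition {c L : ℝ} (hc : 0 < c) (hL : 0 < L) {n : ℕ∞} :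
    ContDiff ℝ n (radialTransition c L) := by
  rw [contDiff_iff_contDiffAt]
  intro y
  by_cases hy : y = 0
  · subst hy
    have hev : radialTransition c L =ᶠ[𝓝 (0 : E3)] fun _ ↦ 0 := by
      filter_upwards [Metric.ball_mem_nhds (0 : E3) hc] with z hz
      rw [Metric.mem_ball, dist_zero_right] at hz
      exact radialTransition_of_norm_le hL hz.le
    exact (contDiffAt_const (c := (0 : ℝ))).congr_of_eventuallyEq hev
  · have h : ContDiffAt ℝ n (fun y : E3 ↦ Real.smoothTransition (L⁻¹ * (‖y‖ - c))) y :=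
      Real.smoothTransition.contDiffAt.comp y
        (contDiffAt_const.mul ((contDiffAt_norm ℝ hy).sub contDiffAt_const))
    exact h

/-- **Slope of the radial transition**: `‖d u_{c,L}‖ ≤ K / L` where `K` bounds `|χ'|` (chain
rule; the norm is `1`-Lipschitz). [folklore] -/
theorem norm_fderiv_radialTransition_le {c L K : ℝ} (hc : 0 < c) (hL : 0 < L)
    (hK : ∀ t, |deriv Real.smoothTransition t| ≤ K) (y : E3) :
    ‖fderiv ℝ (radialTransition c L) y‖ ≤ K / L := by
  have hK0 : 0 ≤ K := (abs_nonneg _).trans (hK 0)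
  by_cases hy : y = 0
  · subst hy
    have hev : radialTransition c L =ᶠ[𝓝 (0 : E3)] fun _ ↦ 0 := by
      filter_upwards [Metric.ball_mem_nhds (0 : E3) hc] with z hz
      rw [Metric.mem_ball, dist_zero_right] at hz
      exact radialTransition_of_norm_le hL hz.le
    rw [hev.fderiv_eq, fderiv_const_apply, norm_zero]
    positivity
  · have hn : HasFDerivAt (fun y : E3 ↦ ‖y‖) (fderiv ℝ (fun y : E3 ↦ ‖y‖) y) y :=
      ((contDiffAt_norm ℝ hy (n := 1)).differentiableAt one_ne_zero).hasFDerivAt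
    have hφ : HasFDerivAt (fun y : E3 ↦ L⁻¹ * (‖y‖ - c)) (L⁻¹ • fderiv ℝ (fun y : E3 ↦ ‖y‖) y) y :=
      (hn.sub_const c).const_mul L⁻¹
    have hST : HasDerivAt Real.smoothTransition (deriv Real.smoothTransition (L⁻¹ * (‖y‖ - c)))
        (L⁻¹ * (‖y‖ - c)) :=
      ((Real.smoothTransition.contDiff (n := 1)).differentiable one_ne_zero _).hasDerivAt
    have hu : HasFDerivAt (radialTransition c L)
        (deriv Real.smoothTransition (L⁻¹ * (‖y‖ - c)) • (L⁻¹ • fderiv ℝ (fun y : E3 ↦ ‖y‖) y)) y :=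
      hST.comp_hasFDerivAt y hφ
    rw [hu.fderiv, norm_smul, norm_smul, Real.norm_eq_abs, Real.norm_eq_abs, abs_of_pos (inv_pos.mpr hL),
      div_eq_mul_inv]
    have h1 : ‖fderiv ℝ (fun y : E3 ↦ ‖y‖) y‖ ≤ 1 := by
      have := norm_fderiv_le_of_lipschitz ℝ (f := fun y : E3 ↦ ‖y‖) (x₀ := y) lipschitzWith_one_norm
      simpa using this
    calc |deriv Real.smoothTransition (L⁻¹ * (‖y‖ - c))| * (L⁻¹ * ‖fderiv ℝ (fun y : E3 ↦ ‖y‖) y‖)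
        ≤ K * (L⁻¹ * 1) := by gcongr; exact hK _
      _ = K * L⁻¹ := by ring

/-- The **tent function** `T(y) = h · u_{ρ,L}(y) · (1 − u_{R,L}(y))`: height `h` on the annulus
`{ρ + L ≤ ‖y‖ ≤ R}`, zero on `{‖y‖ ≤ ρ}` and on `{‖y‖ ≥ R + L}`. [folklore] -/
def tentFn (ρ R L h : ℝ) (y : E3) : ℝ :=
  h * radialTransition ρ L y * (1 - radialTransition R L y)

/-- `0 ≤ T` for `h ≥ 0`. [folklore] -/
theorem tentFn_nonneg {ρ R L h : ℝ} (hh : 0 ≤ h) (y : E3) : 0 ≤ tentFn ρ R L h y :=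
  mul_nonneg (mul_nonneg hh (radialTransition_nonneg _ _ _))
    (sub_nonneg.mpr (radialTransition_le_one _ _ _))

/-- `T ≤ h` for `h ≥ 0`. [folklore] -/
theorem tentFn_le {ρ R L h : ℝ} (hh : 0 ≤ h) (y : E3) : tentFn ρ R L h y ≤ h := by
  have h1 := radialTransition_nonneg ρ L y
  have h2 := radialTransition_le_one ρ L y
  have h3 := radialTransition_nonneg R L y
  have h4 := radialTransition_le_one R L y
  unfold tentFn
  nlinarith [mul_nonneg h1 h3, mul_le_mul h2 (sub_le_self 1 h3) (sub_nonneg.mpr h4) zero_le_one]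

/-- `T = 0` on `{‖y‖ ≤ ρ}`. [folklore] -/
theorem tentFn_of_norm_le {ρ R L h : ℝ} (hL : 0 < L) {y : E3} (hy : ‖y‖ ≤ ρ) :
    tentFn ρ R L h y = 0 := by
  simp [tentFn, radialTransition_of_norm_le hL hy]

/-- `T = 0` on `{‖y‖ ≥ R + L}`. [folklore] -/
theorem tentFn_of_le_norm {ρ R L h : ℝ} (hL : 0 < L) {y : E3} (hy : R + L ≤ ‖y‖) :
    tentFn ρ R L h y = 0 := by
  simp [tentFn, radialTransition_of_le_norm hL hy]

/-- `T = h` on the annulus `{ρ + L ≤ ‖y‖ ≤ R}`. [folklore] -/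
theorem tentFn_eq {ρ R L h : ℝ} (hL : 0 < L) {y : E3} (hy : ρ + L ≤ ‖y‖) (hy' : ‖y‖ ≤ R) :
    tentFn ρ R L h y = h := by
  simp [tentFn, radialTransition_of_le_norm hL hy, radialTransition_of_norm_le hL hy']

/-- The tent function is smooth (`ρ, R, L > 0`). [folklore] -/
theorem contDiff_tentFn {ρ R L h : ℝ} (hρ : 0 < ρ) (hR : 0 < R) (hL : 0 < L) {n : ℕ∞} :
    ContDiff ℝ n (tentFn ρ R L h) :=
  (contDiff_const.mul (contDiff_radialTransition hρ hL)).mul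
    (contDiff_const.sub (contDiff_radialTransition hR hL))

/-- **Slope of the tent function**: `‖dT‖ ≤ 2 h K / L` for `h ≥ 0`. [folklore] -/
theorem norm_fderiv_tentFn_le {ρ R L h K : ℝ} (hρ : 0 < ρ) (hR : 0 < R) (hL : 0 < L)
    (hh : 0 ≤ h) (hK : ∀ t, |deriv Real.smoothTransition t| ≤ K) (y : E3) :
    ‖fderiv ℝ (tentFn ρ R L h) y‖ ≤ 2 * h * K / L := by
  have hK0 : 0 ≤ K := (abs_nonneg _).trans (hK 0)
  have hu : DifferentiableAt ℝ (radialTransition ρ L) y :=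
    (contDiff_radialTransition hρ hL (n := 1)).differentiable one_ne_zero y
  have hv : DifferentiableAt ℝ (radialTransition R L) y :=
    (contDiff_radialTransition hR hL (n := 1)).differentiable one_ne_zero y
  have hT : HasFDerivAt (tentFn ρ R L h)
      ((h * radialTransition ρ L y) • (-(fderiv ℝ (radialTransition R L) y)) +
        (1 - radialTransition R L y) • (h • fderiv ℝ (radialTransition ρ L) y)) y := by
    have h1 : HasFDerivAt (fun y ↦ h * radialTransition ρ L y)
        (h • fderiv ℝ (radialTransition ρ L) y) y := hu.hasFDerivAt.const_mul h
    have h2 : HasFDerivAt (fun y ↦ 1 - radialTransition R L y)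
        (-(fderiv ℝ (radialTransition R L) y)) y := by
      simpa using hv.hasFDerivAt.const_sub 1
    exact h1.mul h2
  rw [hT.fderiv]
  have nu := norm_fderiv_radialTransition_le hρ hL hK y
  have nv := norm_fderiv_radialTransition_le hR hL hK y
  have a1 : |h * radialTransition ρ L y| ≤ h := by
    rw [abs_mul, abs_of_nonneg hh, abs_of_nonneg (radialTransition_nonneg _ _ _)]
    exact mul_le_of_le_one_right hh (radialTransition_le_one _ _ _)
  have a2 : |1 - radialTransition R L y| ≤ 1 := by
    rw [abs_of_nonneg (sub_nonneg.mpr (radialTransition_le_one _ _ _))]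
    exact sub_le_self 1 (radialTransition_nonneg _ _ _)
  calc ‖(h * radialTransition ρ L y) • (-(fderiv ℝ (radialTransition R L) y)) +
        (1 - radialTransition R L y) • (h • fderiv ℝ (radialTransition ρ L) y)‖
      ≤ ‖(h * radialTransition ρ L y) • (-(fderiv ℝ (radialTransition R L) y))‖ +
        ‖(1 - radialTransition R L y) • (h • fderiv ℝ (radialTransition ρ L) y)‖ := norm_add_le _ _
    _ = |h * radialTransition ρ L y| * ‖fderiv ℝ (radialTransition R L) y‖ +
        |1 - radialTransition R L y| * (h * ‖fderiv ℝ (radialTransition ρ L) y‖) := by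
        rw [norm_smul, norm_smul, norm_smul, norm_neg, Real.norm_eq_abs, Real.norm_eq_abs,
          Real.norm_eq_abs, abs_of_nonneg hh]
    _ ≤ h * (K / L) + 1 * (h * (K / L)) := by gcongr
    _ = 2 * h * K / L := by ring

/-- If the coordinate energy density `∑_μ (∂_μψ)²` vanishes at a point, the representative has
zero derivative there. [folklore] -/
theorem fderiv_extend_eq_zero_of_coordEnergyDensity_eq_zero {U : TopologicalSpace.Opens E4}
    {ψ : U → ℝ} {x : E4} (h : coordEnergyDensity U ψ x = 0) :
    fderiv ℝ (Function.extend Subtype.val ψ 0) x = 0 := by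
  rw [← Kerr.sum_sq_fderiv_extend_eq] at h
  have hμ : ∀ μ, fderiv ℝ (Function.extend Subtype.val ψ 0) x (E4.basisVector μ) = 0 := fun μ ↦
    (pow_eq_zero_iff two_ne_zero).mp
      ((Finset.sum_eq_zero_iff_of_nonneg fun μ _ ↦ sq_nonneg _).mp h μ (Finset.mem_univ μ))
  ext w
  rw [Kerr.eq_sum_basisVector w, map_sum]
  simp [hμ]

end Literature.Geometry.Lorentzian

namespace Literature.Geometry.Lorentzian

open MeasureTheory

/-! ### Finite speed of propagation in the far region, from the energy identity -/

/-- **Coarse finite speed of propagation in the far region, proved.** There is a universal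
`s ≥ 1` such that for subextremal `(M, a)`, every smooth solution `ψ` of `□_g ψ = 0` on the Kerr
exterior (ingoing Kerr–Schild chart) whose data on the leaf `{t* = 0}` vanish at all points with
`‖x⃗‖ > ρ`, where `ρ ≥ R_far(M, a)`, satisfies `ψ(x) = 0`, `dψ(x) = 0` at every exterior point
with `x⁰ ≥ 0` and `‖x⃗‖ > ρ + s x⁰`. Proof (domain of dependence by the energy method, with the
far `J^T` identity `kerr_far_TEnergy_comparison_of_farRadius_le` in place of the divergence
theorem): for `h > 0` and `‖y‖ ≥ ρ + s h` take the tent `T` (`tentFn ρ ‖y‖ L h`,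
`L = 8(K+1)h`, slope `≤ 1/4`, `T = 0` on `{‖y‖ ≤ ρ}` and far out, `T(y) = h`); the identity
between the leaf `{t* = 0}` and the graph of `T` over `{‖y‖ > ρ}` (no flux far out, where the
graphs coincide and the data vanish) gives `E^far_T(0) ≤ 8 E^far_0(0) = 0`, so `∑(∂Φ)² = 0`
along the graph of `T` (a.e., hence everywhere by continuity), in particular `dΦ(h, y) = 0`;
then `ψ(h, y) = ψ(0, y) = 0` by integration in `t*`. (Bär–Ginoux–Pfäffle 2007, Ch. 3: the
general statement `supp u ⊂ J(supp data)`; here only the coarse far-region consequence is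
needed and proved.) [cite: BarGinouxPfaffle2007, Ch. 3 Sect. 2 (Cor. 2.4, Thm. 2.9 of the arXiv version)] -/
theorem kerr_far_finite_speed_of_propagation :
    ∃ s : ℝ, 1 ≤ s ∧ ∀ [Kerr.Facts] [Kerr.SliceFacts] (M a : ℝ), Kerr.IsSubextremal M a →
      ∀ ψ : Kerr.exterior M a → ℝ, ContMDiff 𝓘(ℝ, E4) 𝓘(ℝ, ℝ) ∞ ψ →
      (∀ x, (Kerr.smoothMetric M a (Kerr.rPlus M a)).toPseudoRiemannianMetric.dalembertian ψ x
        = 0) →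
      ∀ ρ : ℝ, Kerr.farRadius M a ≤ ρ →
        (∀ x : Kerr.exterior M a, (x : E4) 0 = 0 → ρ < E4.spatialNorm (x : E4) →
          ψ x = 0 ∧ mfderiv 𝓘(ℝ, E4) 𝓘(ℝ, ℝ) ψ x = 0) →
        ∀ x : Kerr.exterior M a, 0 ≤ (x : E4) 0 → ρ + s * (x : E4) 0 < E4.spatialNorm (x : E4) →
          ψ x = 0 ∧ mfderiv 𝓘(ℝ, E4) 𝓘(ℝ, ℝ) ψ x = 0 := by
  classical
  obtain ⟨K, hK0, hK⟩ := Kerr.exists_bound_deriv_smoothTransition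
  refine ⟨8 * (K + 1), by linarith, ?_⟩
  intro instF instS M a hMa ψ hψ hsol ρ hρ hdata x hx0 hxfar
  have hM : 0 < M := hMa.pos
  have hs0 : 0 ≤ 8 * (K + 1) := by positivity
  -- ### the representative `Φ` of `ψ`
  set Φ : E4 → ℝ := Function.extend Subtype.val ψ 0 with hΦ_def
  have hrep : ∀ y : Kerr.exterior M a, ψ y = Φ y := fun y ↦
    (Subtype.val_injective.extend_apply _ _ y).symm
  have hΦat : ∀ x : E4, x ∈ Kerr.exterior M a → ContDiffAt ℝ ∞ Φ x := fun x hx ↦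
    (OpensChart.contMDiffAt_iff ⟨x, hx⟩ ψ Φ hrep).mp (hψ ⟨x, hx⟩)
  have hΦd : ∀ x : E4, x ∈ Kerr.exterior M a → DifferentiableAt ℝ Φ x := fun x hx ↦
    (hΦat x hx).differentiableAt (by simp)
  have hΦon1 : ContDiffOn ℝ 1 Φ ((Kerr.exterior M a) : Set E4) := fun x hx ↦
    ((hΦat x hx).of_le (ENat.natCast_le_of_coe_top_le_withTop le_rfl 1)).contDiffWithinAt
  -- ### geometry
  have hρ0 : 0 < ρ := (Kerr.farRadius_pos M a).trans_le hρ
  have hρaf : Kerr.afRadius a (Kerr.rPlus M a) < ρ := (Kerr.afRadius_lt_farRadius M a).trans_le hρ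
  have hmemU : ∀ (t : ℝ) (y : E3), ρ ≤ ‖y‖ → E4.ofTimeSpace t y ∈ Kerr.exterior M a :=
    fun t y hy ↦ Kerr.ofTimeSpace_mem_exterior_iff.mpr (Kerr.mem_slice_of_lt_norm (hρaf.trans_le hy))
  -- ### the data in terms of `Φ`
  have hdata0 : ∀ y : E3, ρ < ‖y‖ →
      Φ (E4.ofTimeSpace 0 y) = 0 ∧ fderiv ℝ Φ (E4.ofTimeSpace 0 y) = 0 := by
    intro y hy
    have hx : E4.ofTimeSpace 0 y ∈ Kerr.exterior M a := hmemU 0 y hy.le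
    have h := hdata ⟨_, hx⟩ (E4.ofTimeSpace_apply_zero 0 y)
      (by rw [E4.spatialNorm_ofTimeSpace]; exact hy)
    exact ⟨(hrep ⟨_, hx⟩).symm.trans h.1, Kerr.fderiv_extend_eq_zero (by simp) hψ ⟨_, hx⟩ h.2⟩
  -- ### KEY CLAIM: `dΦ(h, y) = 0` for `h > 0`, `‖y‖ ≥ ρ + s h`
  have hD : ∀ h : ℝ, 0 < h → ∀ y : E3, ρ + 8 * (K + 1) * h ≤ ‖y‖ →
      fderiv ℝ Φ (E4.ofTimeSpace h y) = 0 := by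
    intro h hh y hy
    set L : ℝ := 8 * (K + 1) * h with hL_def
    have hL : 0 < L := by positivity
    have hyρ : ρ < ‖y‖ := by linarith
    have hR : 0 < ‖y‖ := hρ0.trans hyρ
    set T : E3 → ℝ := tentFn ρ ‖y‖ L h with hT_def
    have hT1 : ContDiff ℝ 1 T := contDiff_tentFn (n := 1) hρ0 hR hL
    have hTslope : ∀ z, ‖fderiv ℝ T z‖ ≤ 1 / 4 := by
      intro z
      refine (norm_fderiv_tentFn_le hρ0 hR hL hh.le hK z).trans ?_
      rw [hL_def, div_le_iff₀ (by positivity)]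
      nlinarith
    have hT0 : ∀ z : E3, ‖z‖ ≤ ρ → (0 : E3 → ℝ) z = T z := fun z hz ↦ by
      rw [Pi.zero_apply, hT_def, tentFn_of_norm_le hL hz]
    have hTnn : ∀ z : E3, (0 : E3 → ℝ) z ≤ T z := fun z ↦ by
      rw [Pi.zero_apply]; exact tentFn_nonneg hh.le z
    have hTy : T y = h := tentFn_eq hL (by linarith) le_rfl
    have hzero1 : ContDiff ℝ 1 (0 : E3 → ℝ) := contDiff_const
    have hzslope : ∀ z : E3, ‖fderiv ℝ (0 : E3 → ℝ) z‖ ≤ 1 / 4 := fun z ↦ by simp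
    -- the far `J^T` identity between the leaf `{t* = 0}` and the graph of `T`
    have hB := kerr_far_TEnergy_comparison_of_farRadius_le hMa hρ hzero1 hT1 hzslope hTslope hT0
      hTnn ψ 0 hψ hsol ⟨‖y‖ + L, fun x hx1 hx2 hx3 ↦ ?_⟩
    swap
    · -- beyond `‖y‖ + L` the two graphs coincide with the leaf, where the data vanish
      have hsn : E4.spatialNorm (x : E4) = ‖E4.spatial (x : E4)‖ := rfl
      have hTx : T (E4.spatial (x : E4)) = 0 := tentFn_of_le_norm hL (by rw [← hsn]; exact hx3)
      simp only [Pi.zero_apply, add_zero, zero_add] at hx1 hx2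
      rw [hTx] at hx2
      exact hdata x (le_antisymm hx2 hx1) (by rw [hsn] at hx3 ⊢; linarith)
    -- the far energy through the leaf vanishes
    set S : Set E3 := {z | ρ < ‖z‖} with hS_def
    have hS_open : IsOpen S := isOpen_lt continuous_const continuous_norm
    have hS_meas : MeasurableSet S := hS_open.measurableSet
    have hE0 : graphSliceEnergyOn (Kerr.exterior M a) ψ 0 0 S = 0 := by
      unfold graphSliceEnergyOn
      refine Eq.trans (setLIntegral_congr_fun (g := fun _ ↦ (0 : ENNReal)) hS_meas
        fun z hz ↦ ?_) lintegral_zero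
      rw [Set.indicator_of_mem]
      · simp only [Pi.zero_apply, add_zero]
        rw [← Kerr.sum_sq_fderiv_extend_eq, (hdata0 z hz).2]
        simp
      · exact hmemU _ z (le_of_lt hz)
    -- hence so does the far energy through the graph of `T`
    have hET : graphSliceEnergyOn (Kerr.exterior M a) ψ T 0 S = 0 :=
      nonpos_iff_eq_zero.mp (hB.1.trans (by rw [hE0, mul_zero]))
    have hET' : ∫⁻ z in S, ENNReal.ofReal
        (coordEnergyDensity (Kerr.exterior M a) ψ (E4.ofTimeSpace (0 + T z) z)) = 0 := by
      rw [← hET]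
      unfold graphSliceEnergyOn
      refine setLIntegral_congr_fun hS_meas fun z hz ↦ ?_
      rw [Set.indicator_of_mem]
      exact hmemU _ z (le_of_lt hz)
    -- continuity of the energy density along the graph of `T` over `S`
    have hcont : ContinuousOn
        (fun z ↦ coordEnergyDensity (Kerr.exterior M a) ψ (E4.ofTimeSpace (0 + T z) z)) S := by
      have hfd : ContinuousOn (fderiv ℝ Φ) ((Kerr.exterior M a) : Set E4) :=
        hΦon1.continuousOn_fderiv_of_isOpen (Kerr.exterior M a).isOpen le_rfl
      have hP : Continuous fun z ↦ E4.ofTimeSpace (0 + T z) z :=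
        (Kerr.contDiff_graphMap (n := 0) (hT1.of_le zero_le_one) 0).continuous
      have hPS : Set.MapsTo (fun z ↦ E4.ofTimeSpace (0 + T z) z) S
          ((Kerr.exterior M a) : Set E4) := fun z hz ↦ hmemU _ z (le_of_lt hz)
      have hcomp : ContinuousOn (fun z ↦ fderiv ℝ Φ (E4.ofTimeSpace (0 + T z) z)) S :=
        hfd.comp hP.continuousOn hPS
      have heq : (fun z ↦ coordEnergyDensity (Kerr.exterior M a) ψ (E4.ofTimeSpace (0 + T z) z)) =
          fun z ↦ ∑ μ, (fderiv ℝ Φ (E4.ofTimeSpace (0 + T z) z) (E4.basisVector μ)) ^ 2 :=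
        funext fun z ↦ (Kerr.sum_sq_fderiv_extend_eq _ ψ _).symm
      rw [heq]
      exact continuousOn_finsetSum _ fun μ _ ↦ (hcomp.clm_apply continuousOn_const).pow 2
    have hae : (fun z ↦ coordEnergyDensity (Kerr.exterior M a) ψ (E4.ofTimeSpace (0 + T z) z))
        =ᵐ[volume.restrict S] fun _ ↦ (0 : ℝ) := by
      have h0 := (lintegral_eq_zero_iff'
        (ENNReal.measurable_ofReal.comp_aemeasurable (hcont.aemeasurable hS_meas))).mp hET'
      filter_upwards [h0] with z hz
      exact le_antisymm (ENNReal.ofReal_eq_zero.mp hz) (coordEnergyDensity_nonneg _ _ _)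
    have heqOn := Measure.eqOn_open_of_ae_eq hae hS_open hcont continuousOn_const
    have he0 : coordEnergyDensity (Kerr.exterior M a) ψ (E4.ofTimeSpace (0 + T y) y) = 0 :=
      heqOn hyρ
    rw [zero_add, hTy] at he0
    exact fderiv_extend_eq_zero_of_coordEnergyDensity_eq_zero he0
  -- ### conclusion at the point `x = (t₀, y₀)`
  set t₀ : ℝ := (x : E4) 0 with ht₀_def
  set y₀ : E3 := E4.spatial (x : E4) with hy₀_def
  have hxeq : (x : E4) = E4.ofTimeSpace t₀ y₀ := eq_ofTimeSpace _
  have hsn : E4.spatialNorm (x : E4) = ‖y₀‖ := rfl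
  rw [hsn] at hxfar
  have hy₀ρ : ρ < ‖y₀‖ := by nlinarith
  rcases hx0.eq_or_lt with ht0 | ht0
  · exact hdata x ht0.symm (by rw [hsn]; exact hy₀ρ)
  · -- `dΦ = 0` along the segment `{(t, y₀) : 0 ≤ t ≤ t₀}`
    have hdΦ : ∀ t ∈ Set.Icc 0 t₀, fderiv ℝ Φ (E4.ofTimeSpace t y₀) = 0 := by
      intro t ht
      rcases ht.1.eq_or_lt with h0 | h0
      · rw [← h0]; exact (hdata0 y₀ hy₀ρ).2
      · exact hD t h0 y₀ (by nlinarith [ht.2])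
    refine ⟨?_, ?_⟩
    · -- `ψ x = Φ(t₀, y₀) = Φ(0, y₀) = 0`
      rw [hrep x, hxeq]
      have hg : ∀ t ∈ Set.Icc 0 t₀, Φ (E4.ofTimeSpace t y₀) = Φ (E4.ofTimeSpace 0 y₀) := by
        have hderiv : ∀ t, HasDerivAt (fun t ↦ Φ (E4.ofTimeSpace t y₀))
            (fderiv ℝ Φ (E4.ofTimeSpace t y₀) (E4.basisVector 0)) t := by
          intro t
          have hl : HasDerivAt (fun t : ℝ ↦ E4.ofTimeSpace t y₀) (E4.basisVector 0) t := by
            have : (fun t : ℝ ↦ E4.ofTimeSpace t y₀) =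
                fun t ↦ t • E4.basisVector 0 + E4.spaceEmbed y₀ :=
              funext fun t ↦ E4.ofTimeSpace_eq_smul_add' _ _
            rw [this]
            simpa using ((hasDerivAt_id t).smul_const (E4.basisVector 0)).add_const
              (E4.spaceEmbed y₀)
          exact (hΦd _ (hmemU t y₀ hy₀ρ.le)).hasFDerivAt.comp_hasDerivAt t hl
        refine constant_of_has_deriv_right_zero (fun t _ ↦ (hderiv t).continuousAt.continuousWithinAt)
          fun t ht ↦ ?_
        have := hderiv t
        rw [hdΦ t ⟨ht.1, ht.2.le⟩, zero_apply] at this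
        exact this.hasDerivWithinAt
      rw [hg t₀ ⟨hx0, le_rfl⟩]
      exact (hdata0 y₀ hy₀ρ).1
    · rw [OpensChart.mfderiv_eq x ψ Φ hrep (hΦd _ x.2), hxeq]
      exact hdΦ t₀ ⟨hx0, le_rfl⟩

end Literature.Geometry.Lorentzian

namespace Literature.Geometry.Lorentzian


/-! ### gr.S24 boundedness from the printed theorem alone -/

/-- **Reduction of gr.S24 boundedness to the printed theorem.** The named fact
`drsr_wave_boundedness_kerr` of `BlackHoles.lean` (uniform boundedness of the coordinate energy
through the Kerr–Schild leaves `{t* = τ} ∩ {r > r₊}`, for smooth solutions with compactly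
supported data on `{t* = 0}`) follows from Dafermos–Rodnianski–Shlapentokh-Rothman's Theorem 3.1
(23) for admissible hypersurfaces (`DafermosRodnianskiShlapentokhRothman2016_energyBoundedness`)
alone: the far-region `J^T` comparison and the (coarse, far-region) finite speed of propagation
used in `drsr_wave_boundedness_kerr_of` (`KerrWaveEnergy.lean`) are now the theorems
`kerr_far_TEnergy_comparison_of_farRadius_le` (constant `8`) and
`kerr_far_finite_speed_of_propagation` (speed `s`). Proof: with `B` a bound for
`|heightProfile'|`, put `A = 4MB + 2M`, `λ = max (max (4A) (4Ms)) R_far(M, a)` and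
`F = heightFn M λ`; then `F` is admissible with slope `≤ A/λ ≤ 1/4`, vanishes on `{‖y‖ ≤ λ}`,
and `0 ≤ sF ≤ ‖y‖/2`. For an admissible wave `ψ` with data supported in a compact
`K ⊆ {‖x⃗‖ ≤ ρ}`, `ρ ≥ R_far`, finite speed of propagation makes `ψ, dψ` vanish on
`{x⁰ ≥ 0, ‖x⃗‖ > ρ + s x⁰}`; hence the data of `ψ` on the graph of `F` are supported in the
compact `K ∪ {(F(y), y) : λ ≤ ‖y‖ ≤ 2ρ}`, and `ψ` vanishes on the wedges `{τ ≤ x⁰ ≤ τ + F}`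
beyond `‖x⃗‖ = 2(ρ + sτ) + 1`. Splitting each energy into the parts over `{‖y‖ ≤ λ}` (where the
graphs of `0` and `F` coincide) and `{‖y‖ > λ}` (compared by the `J^T` identity, constant `8`)
gives `E_KS(τ) ≤ 8 E_F(τ) ≤ 8 C_A E_F(0) ≤ 64 C_A E_KS(0)`, with `64 C_A < ∞` depending only on
`(M, a)`. This is the argument of Dafermos–Rodnianski for Prop. 4.6.1 of arXiv:1010.5132, §4.6
("extending initial data, an easy domain of dependence argument, and the fact that `T` is
timelike … near infinity"). [cite: DafermosRodnianski2010KerrSmallA, §4.6 Prop. 4.6.1] -/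
theorem drsr_wave_boundedness_kerr_of_DRSR
    (hA : DafermosRodnianskiShlapentokhRothman2016_energyBoundedness) :
    drsr_wave_boundedness_kerr := by
  obtain ⟨s, hs1, hCfar⟩ := kerr_far_finite_speed_of_propagation
  have hs0 : 0 ≤ s := zero_le_one.trans hs1
  intro instF instS M a hMa
  have hM : 0 < M := hMa.pos
  -- the height function and its scale
  obtain ⟨B, hB0, hBd⟩ := exists_bound_deriv_heightProfile
  set A : ℝ := 4 * M * B + 2 * M with hA_def
  have hA0 : 0 ≤ A := by positivity
  set l : ℝ := max (max (4 * A) (4 * M * s)) (Kerr.farRadius M a) with hl_def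
  have hl_A : 4 * A ≤ l := (le_max_left _ _).trans (le_max_left _ _)
  have hl_s : 4 * M * s ≤ l := (le_max_right _ _).trans (le_max_left _ _)
  have hl_far : Kerr.farRadius M a ≤ l := le_max_right _ _
  have hl_af : Kerr.afRadius a (Kerr.rPlus M a) < l :=
    (Kerr.afRadius_lt_farRadius M a).trans_le hl_far
  have hl : 0 < l := (Kerr.farRadius_pos M a).trans_le hl_far
  set F : E3 → ℝ := heightFn M l with hF_def
  have hF_smooth : ContDiff ℝ ∞ F := contDiff_heightFn M l
  have hF_C1 : ContDiff ℝ 1 F := hF_smooth.of_le (ENat.natCast_le_of_coe_top_le_withTop le_rfl 1)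
  have hF_slope : ∀ y : E3, ‖fderiv ℝ F y‖ ≤ 1 / 4 := by
    intro y
    have h := norm_fderiv_heightFn_le_div hM.le hl hB0 hBd y
    have h2 : A / l ≤ 1 / 4 := by
      rw [div_le_iff₀ hl]; linarith
    rw [← hA_def] at h
    linarith
  have hF_zero : ∀ y : E3, ‖y‖ ≤ l → F y = 0 := fun y hy ↦ heightFn_of_norm_le hl hy
  have hF_nonneg : ∀ y : E3, 0 ≤ F y := heightFn_nonneg hM.le l
  have hF_sF : ∀ y : E3, s * F y ≤ ‖y‖ / 2 := by
    intro y
    have h := heightFn_le hM.le hl y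
    have h1 : s * F y ≤ s * (2 * M * ‖y‖ / l) := mul_le_mul_of_nonneg_left h hs0
    have h2 : s * (2 * M * ‖y‖ / l) ≤ ‖y‖ / 2 := by
      rw [← mul_div_assoc, div_le_div_iff₀ hl (by norm_num : (0:ℝ) < 2)]
      nlinarith [norm_nonneg y]
    exact h1.trans h2
  have hF_half : ∀ y : E3, F y ≤ ‖y‖ / 2 := fun y ↦
    (le_mul_of_one_le_left (hF_nonneg y) hs1).trans (hF_sF y)
  have hF_adm : Kerr.IsAdmissibleHeight M F :=
    ⟨hF_smooth, ⟨3 / 4, by norm_num, fun y ↦ by linarith [hF_slope y]⟩, _,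
      tendsto_heightFn_sub_log hl⟩
  -- the printed theorem, with its constant
  obtain ⟨CA, hCA, hAψ⟩ := hA M a hMa F hF_adm
  have hzero_C1 : ContDiff ℝ 1 (0 : E3 → ℝ) := contDiff_const
  have hzero_slope : ∀ y : E3, ‖fderiv ℝ (0 : E3 → ℝ) y‖ ≤ 1 / 4 := by
    intro y; simp
  refine ⟨8 * CA * 8, ENNReal.mul_lt_top (ENNReal.mul_lt_top (by simp) hCA) (by simp),
    fun ψ hψ τ hτ ↦ ?_⟩
  obtain ⟨hsmooth, hsol, K, hK, hdata⟩ := hψ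
  obtain ⟨ρ₀, -, hρ₀⟩ := exists_spatialNorm_le_of_isCompact hK
  set ρ : ℝ := max ρ₀ (Kerr.farRadius M a) with hρ_def
  have hρfar : Kerr.farRadius M a ≤ ρ := le_max_right _ _
  have hρ0 : 0 ≤ ρ := (Kerr.farRadius_pos M a).le.trans hρfar
  have hρ : ∀ x ∈ K, E4.spatialNorm (x : E4) ≤ ρ := fun x hx ↦ (hρ₀ x hx).trans (le_max_left _ _)
  -- finite speed of propagation (far region, speed `s`)
  have hvan : ∀ x : Kerr.exterior M a, 0 ≤ (x : E4) 0 →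
      ρ + s * (x : E4) 0 < E4.spatialNorm (x : E4) →
      ψ x = 0 ∧ mfderiv 𝓘(ℝ, E4) 𝓘(ℝ, ℝ) ψ x = 0 := by
    refine hCfar M a hMa ψ hsmooth hsol ρ hρfar fun x hx0 hxρ ↦ hdata x hx0 fun hxK ↦ ?_
    exact absurd (hρ x hxK) (not_le.mpr hxρ)
  -- `ψ` has compactly supported data on the graph of `F`
  have hψF : IsAdmissibleKerrWaveOn M a F ψ := by
    refine ⟨hsmooth, hsol, ?_⟩
    set B₂ : Set E4 := (fun y : E3 ↦ E4.ofTimeSpace (F y) y) '' {y | l ≤ ‖y‖ ∧ ‖y‖ ≤ 2 * ρ}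
      with hB₂_def
    have hB₂c : IsCompact B₂ := by
      refine IsCompact.image ?_ ?_
      · have : {y : E3 | l ≤ ‖y‖ ∧ ‖y‖ ≤ 2 * ρ} =
            {y | l ≤ ‖y‖} ∩ Metric.closedBall 0 (2 * ρ) := by
          ext y; simp [Metric.mem_closedBall, dist_zero_right]
        rw [this]
        exact (isCompact_closedBall _ _).inter_left (isClosed_le continuous_const continuous_norm)
      · exact E4.continuous_ofTimeSpace' hF_smooth.continuous continuous_id
    have hB₂sub : B₂ ⊆ (Kerr.exterior M a : Set E4) := by
      rintro _ ⟨y, ⟨hy1, _⟩, rfl⟩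
      exact Kerr.ofTimeSpace_mem_exterior_iff.mpr (Kerr.mem_slice_of_lt_norm (hl_af.trans_le hy1))
    set K' : Set (Kerr.exterior M a) := K ∪ Subtype.val ⁻¹' B₂ with hK'_def
    have hK'c : IsCompact K' := by
      refine hK.union ?_
      have hrange : B₂ ⊆ Set.range (Subtype.val : Kerr.exterior M a → E4) :=
        fun x hx ↦ ⟨⟨x, hB₂sub hx⟩, rfl⟩
      rw [Topology.IsEmbedding.subtypeVal.isCompact_iff, Set.image_preimage_eq_of_subset hrange]
      exact hB₂c
    refine ⟨K', hK'c, fun x hx0 hxK' ↦ ?_⟩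
    set y : E3 := E4.spatial (x : E4) with hy_def
    have hxy : (x : E4) = E4.ofTimeSpace (F y) y := by rw [← hx0]; exact eq_ofTimeSpace _
    have hsn : E4.spatialNorm (x : E4) = ‖y‖ := rfl
    by_cases hfar : 2 * ρ < ‖y‖
    · refine hvan x (hx0 ▸ hF_nonneg y) ?_
      rw [hsn, hx0]
      linarith [hF_sF y]
    · push Not at hfar
      by_cases hnear : l ≤ ‖y‖
      · exact absurd (Or.inr ⟨y, ⟨hnear, hfar⟩, hxy.symm⟩ : x ∈ K') hxK'
      · push Not at hnear
        have h0 : (x : E4) 0 = 0 := by rw [hx0, hF_zero y hnear.le]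
        exact hdata x h0 fun hxK ↦ hxK' (Or.inl hxK)
  -- the far comparison at times `t ≥ 0` (a theorem)
  have hBt : ∀ t : ℝ, 0 ≤ t →
      graphSliceEnergyOn (Kerr.exterior M a) ψ F t {y | l < ‖y‖} ≤
          8 * graphSliceEnergyOn (Kerr.exterior M a) ψ 0 t {y | l < ‖y‖} ∧
        graphSliceEnergyOn (Kerr.exterior M a) ψ 0 t {y | l < ‖y‖} ≤
          8 * graphSliceEnergyOn (Kerr.exterior M a) ψ F t {y | l < ‖y‖} := by
    intro t ht
    refine kerr_far_TEnergy_comparison_of_farRadius_le hMa hl_far (F₁ := 0) (F₂ := F) hzero_C1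
      hF_C1 hzero_slope hF_slope (fun y hy ↦ by simp [hF_zero y hy])
      (fun y ↦ by simpa using hF_nonneg y) ψ t hsmooth hsol
      ⟨2 * (ρ + s * t) + 1, fun x hx1 hx2 hx3 ↦ ?_⟩
    simp only [Pi.zero_apply, add_zero] at hx1
    refine hvan x (ht.trans hx1) ?_
    have hsn : E4.spatialNorm (x : E4) = ‖E4.spatial (x : E4)‖ := rfl
    have hh := hF_sF (E4.spatial (x : E4))
    have h2 := mul_le_mul_of_nonneg_left hx2 hs0
    rw [hsn] at hx3 ⊢
    nlinarith
  -- measurability of the far region; the graphs of `0` and `F` agree over the near region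
  have hS : MeasurableSet {y : E3 | l < ‖y‖} :=
    (isOpen_lt continuous_const continuous_norm).measurableSet
  have hagree : ∀ t : ℝ, graphSliceEnergyOn (Kerr.exterior M a) ψ 0 t {y : E3 | l < ‖y‖}ᶜ =
      graphSliceEnergyOn (Kerr.exterior M a) ψ F t {y : E3 | l < ‖y‖}ᶜ := by
    intro t
    refine graphSliceEnergyOn_congr_height _ ψ t hS.compl fun y hy ↦ ?_
    simp only [Set.mem_compl_iff, Set.mem_setOf_eq, not_lt] at hy
    simp only [Pi.zero_apply]
    exact (hF_zero y hy).symm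
  have hD1 : (1 : ENNReal) ≤ 8 := by norm_num
  -- near/far decomposition at times `t ≥ 0`, in both directions
  have hcmp1 : ∀ t : ℝ, 0 ≤ t →
      sliceEnergy (Kerr.exterior M a) ψ t ≤ 8 * graphSliceEnergy (Kerr.exterior M a) ψ F t := by
    intro t ht
    rw [← graphSliceEnergy_zero_height, ← graphSliceEnergyOn_add_compl _ ψ 0 t hS,
      ← graphSliceEnergyOn_add_compl _ ψ F t hS, hagree t, mul_add]
    gcongr ?_ + ?_
    · exact (hBt t ht).2
    · exact le_mul_of_one_le_left' hD1
  have hcmp2 : ∀ t : ℝ, 0 ≤ t →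
      graphSliceEnergy (Kerr.exterior M a) ψ F t ≤ 8 * sliceEnergy (Kerr.exterior M a) ψ t := by
    intro t ht
    rw [← graphSliceEnergy_zero_height, ← graphSliceEnergyOn_add_compl _ ψ 0 t hS,
      ← graphSliceEnergyOn_add_compl _ ψ F t hS, hagree t, mul_add]
    gcongr ?_ + ?_
    · exact (hBt t ht).1
    · exact le_mul_of_one_le_left' hD1
  calc sliceEnergy (Kerr.exterior M a) ψ τ
      ≤ 8 * graphSliceEnergy (Kerr.exterior M a) ψ F τ := hcmp1 τ hτ
    _ ≤ 8 * (CA * graphSliceEnergy (Kerr.exterior M a) ψ F 0) := by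
        gcongr; exact hAψ ψ hψF τ hτ
    _ ≤ 8 * (CA * (8 * sliceEnergy (Kerr.exterior M a) ψ 0)) := by
        gcongr; exact hcmp2 0 le_rfl
    _ = 8 * CA * 8 * sliceEnergy (Kerr.exterior M a) ψ 0 := by ring

end Literature.Geometry.Lorentzian

end
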